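import Summits.SmoothPoincare4.SmoothPoincare4.Theses.ConvexBisection
import Summits.SmoothPoincare4.SmoothPoincare4.Theses.NoOneHandles
import Summits.SmoothPoincare4.SmoothPoincare4.Theorems.AcyclicBisectionRigidity.Negative.SeamCompatible
import Summits.SmoothPoincare4.SmoothPoincare4.Theorems.ConvexBisectionAcyclicBisectionRigidityStubSteinHandleNormalForm
import Summits.SmoothPoincare4.SmoothPoincare4.Theorems.ConvexBisectionAcyclicBisectionRigidityStubFactGompf
import Summits.SmoothPoincare4.SmoothPoincare4.Theorems.AcyclicBisectionRigidity.Negative.LoadBearing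
import Summits.SmoothPoincare4.SmoothPoincare4.Theorems.ContractibleTwistedDoubleStandard.Negative.DoubleBisection
import Summits.SmoothPoincare4.SmoothPoincare4.Theorems.ConvexBisectionAcyclicBisectionRigidityStubPropertyRClosing
import Summits.SmoothPoincare4.SmoothPoincare4.Theorems.ConvexBisectionAcyclicBisectionRigidityStubPropertyRGluing
import Summits.SmoothPoincare4.SmoothPoincare4.Theorems.ConvexBisectionAcyclicBisectionRigidityStubDoubleHalfContractible
import Summits.SmoothPoincare4.SmoothPoincare4.Theorems.ConvexBisectionAcyclicBisectionRigidityStubPropertyRRecognition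
import Summits.SmoothPoincare4.SmoothPoincare4.Theorems.ConvexBisectionAcyclicBisectionRigidityStubResidualBall
import Summits.SmoothPoincare4.SmoothPoincare4.Theorems.ConvexBisectionAcyclicBisectionRigidityStubMazurDouble
import Summits.SmoothPoincare4.SmoothPoincare4.Theorems.ConvexBisectionAcyclicBisectionRigiditySeamGluingTransport
import Summits.SmoothPoincare4.SmoothPoincare4.Theorems.ConvexBisectionAcyclicBisectionRigiditySeamGluingCrux
import Literature.Topology.FourManifolds.SphereFourOneZeroOneSplitting
import Literature.Topology.FourManifolds.MazurDouble
import Literature.Topology.FourManifolds.MazurDoubleHolds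
import Literature.Topology.FourManifolds.PropertyRTraceBridgeOfPropertyRHolds
import Literature.Topology.FourManifolds.Handles
import Literature.Topology.FourManifolds.CerfGammaFour
import Literature.Topology.FourManifolds.CerfGammaFourProofs
import Literature.Topology.FourManifolds.ClosedBallHandles
import Literature.Topology.FourManifolds.GluingProofs
import Literature.Geometry.Symplectic.SteinFillingSphere
import Literature.Topology.FourManifolds.PropertyRTraceClosing
import Literature.Topology.FourManifolds.Gluing
import Literature.Topology.FourManifolds.HomotopyS4CompactProofs
import Literature.Topology.FourManifolds.HomotopyS4OrientableProofs
import Literature.Topology.FourManifolds.MorseProofs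
import HarnessLib

/-!
# Line `seam-duality-cancellation` for crux `ConvexBisection.AcyclicBisectionRigidity`
(item stmt-SmoothPoincare4-10507, route `route-SmoothPoincare4-ConvexBisection`, rank 2; round 2)

Skeleton (crux-plan, planner-cruxplan-stmt-SmoothPoincare4-10507-seam-duality-cancell-0, 2026-08-16) of the
card `Cruxes/AcyclicBisectionRigidity/Ideas/seam-duality-cancellation.md` ("cancel the 1-handle of one half
against the dual 2-handle of the OTHER half"), reshaped by the three round-2 triage notes (TRIAGE-r2-1/2/3,
all `pass`, all `merge ≈ exchange-recognition`): the lever lives on the MAZUR–MAZUR sector (both halves admit a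
handle decomposition with one 0-, one 1-, one 2-handle), where cross-seam cancellation + Gabai's Property R is
unconditional once the seam pair is DUAL, and Mazur's `W × I = B⁵` closes the PARALLEL case; everything with
more 1-handles is the residual (there complete duality is Generalised-Property-R-shaped, card K3, and the
engine is the sibling's exchange / dot-swap lemma, Disproof §13b, TRIAGE-r2-3 (O2)).

THE CRUX. For every Hausdorff second-countable `C^∞` 4-manifold `M ≃ₕ S⁴`: if `M = e₁(W₁) ∪ e₂(W₂)` for two
smoothly embedded compact Stein domains meeting exactly along the images of their boundaries, with the
complex tangencies `ξᵢ = contactPlane Jᵢ.J` pushed forward to the same plane field on the seam, and both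
halves ℚ-acyclic in positive degrees, then `M ≅ S⁴`.

THE LINE (four stubs; composition `AcyclicBisectionRigidity_of`, kernel-checked, no `sorry` of its own; the
case split is on `MM := HasHandleDecomposition 3 W₁ (1,1,1) ∧ HasHandleDecomposition 3 W₂ (1,1,1)`).
* `stub_seamPairDichotomy` — THE LEVER (new; card K1 + P1's cancellation half; rank: hardest). In the
  Mazur–Mazur sector the glued homotopy sphere, read from `W₁`'s side, is
  `M = h⁰ ∪ h¹ ∪ h²(ℓ₁) ∪ h²(γ₂) ∪ h³ ∪ h⁴` with `h²(γ₂)` = the 2-handle of `W₂` turned upside down, attached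
  to `Γ = ∂W₁` along the SEAM KNOT `γ₂ := (e₁⁻¹ ∘ e₂)`(belt circle of `W₂`'s 2-handle) with its cocore framing.
  SEAM-PAIR DICHOTOMY: `γ₂` is either DUAL (after an isotopy in `Γ` it lies in `∂(h⁰ ∪ h¹) ∖ ν(ℓ₁) ⊂ S¹×S²` and
  meets some non-separating 2-sphere of `S¹×S²` transversally in ONE point — TRIAGE-r2-3's wording) or PARALLEL
  (isotopic in `Γ` to the belt circle `γ₁` of `h²(ℓ₁)` with matching cocore framings). Typed by its OUTPUT:
  dual ⇒ `h¹`, `h²(γ₂)` cancel (Milnor's First Cancellation Theorem), so `M` carries a Morse function of type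
  `(1,0,1,1,1)`; parallel ⇒ `M`'s 2-handlebody is that of `D(W₁)`, so `M ≅ D(W₁)` (Laudenbach–Poénaru) and
  `M` is an `IsDouble` of `W₁`.
* `stub_propertyR_recognition` — THE PROPERTY-R ENDGAME (known theorem, to vendor; card P1's second half).
  A closed smooth 4-manifold with a Morse function of type `(1,0,1,1,1)` is `S⁴`: `h⁰ ∪ h² = X_n(K)` has
  `∂ = ∂(h³ ∪ h⁴) = S¹×S²`, so `n = 0` and `K` is the unknot (Gabai 1987, Property R), `X₀(U) = S²×D²`, and
  `S²×D² ∪_φ S¹×B³ ≅ S⁴` for every `φ` (Laudenbach–Poénaru, genus 1). No homotopy-sphere hypothesis.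
* `stub_mazurDouble` — THE PARALLEL HORN'S ENDGAME (known theorem, to vendor: Mazur 1961). A homotopy-sphere
  double `D(W)` of a compact `W` of handle type `(1,1,1)` is `S⁴`: `π₁ W ↪ π₁ D(W) = 1`, so the attaching
  circle of `h²` is homotopic, hence (dimension 5) isotopic, to `S¹ × pt` in `∂(S¹×B⁴)`; `W × I ≅ B⁵` and
  `D(W) = ∂(W × I) ≅ S⁴`.
* `stub_residual` — RESIDUAL (`¬MM`: some half needs a 0-handle only — seam `S³`, the route's known support
  `SphereSeamStandard` — or at least two 1-handles). NOT claimed by the line; crux-sized and SPC4-shielded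
  (`residual_of_crux` below). Engines owned elsewhere: the exchange / dot-swap lemma (sibling line
  `exchange-recognition`, Disproof §13b, TRIAGE-r2-3 (O2): settles Hayden's `r = 2` inhabitant `M_H ≅ S⁴`
  and all symmetric-link cork twists), partial cross-seam cancellation (lowers the handle count of a
  bisection; complete duality with `r ≥ 2` one-handles lands on Generalised Property R — barrier
  `StrictPropertyTwoRBarrier`, card K3, honestly not evaded), the lens lift for finite-`π₁` halves with
  `≥ 2` one-handles (T6 spheres of Disproof §13d).
* `AcyclicBisectionRigidity_of : ConvexBisection.AcyclicBisectionRigidity` — `by_cases MM`; on `MM` apply the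
  dichotomy, then `stub_propertyR_recognition` (compactness of `M` from the PROVED tree fact
  `compactSpace_of_homotopyEquiv_sphere_four_holds`) or `stub_mazurDouble` (`W₁` Hausdorff second countable
  through the embedding `e₁`); on `¬MM` the residual.

DISPROOF USED (`Cruxes/AcyclicBisectionRigidity/Disproof.lean` gen 5 v17, read 2026-08-16, cited by §).
`false_without_homotopyEquiv` (H = `M ≃ₕ S⁴` is load-bearing): the line uses H at `stub_seamPairDichotomy`
(`π₁ M = 1` forces the seam knot `γ₂` to generate `π₁ W₁ = ℤ/a`, i.e. ALGEBRAIC duality — the stub is its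
geometric upgrade; without H a kernel-preserving non-extending regluing `X_p ∪_ψ X̄_p` with `π₁ = ℤ/p` would be
neither dual nor a double; in the torsion sub-sector `π₁ Wᵢ ≠ 1` H moreover EMPTIES the parallel horn, because
`π₁ D(W₁) = π₁ W₁ ≠ 1`, so there the stub asserts duality outright — instance: the rational Price twists `M_p`,
§5d (d), `w = 1`; mismatched parallel framings and `γ₂` inside a 3-ball are excluded by the handle structure
alone — `∂(W₁ ∪ h²(γ₂)) = ∂(h³ ∪ h⁴) = S¹×S²` is prime with `H₁ = ℤ` — unless `Γ = S³`, where `ℓ₁ = S¹ × pt` by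
Property R read in `S¹×S²` and every `γ₂` becomes dual after one slide over `ℓ₁`), at
`stub_mazurDouble` (`π₁ W = 1` from `π₁ D(W) = 1`) and at `stub_residual`; it is NOT used at
`stub_propertyR_recognition`, which is a theorem about all closed 4-manifolds (the homotopy type is forced by
the handle count). `collapse_without_acyclic`: ℚ-acyclicity is what makes the pattern balanced (as many dual
2-handles as 1-handles; `χ(Wᵢ) = 1`), and the Mazur–Mazur sector is its minimal instance. §1 `shielded_of_spc4`:
`stub_seamPairDichotomy` and `stub_residual` have the shielded shape (conclusions implied by `M ≅ S⁴` once `S⁴`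
is known to carry a `(1,0,1,1,1)` Morse function) — acknowledged: the typed lever is the MM-sector of the crux
in handle normal form, its content is the seam-pair mechanism of the docstring, refutable instance-wise
(one wrapping number per example) but not by an exotic-sphere-free certificate. §4b/§12 (`DoubleSector` =
presentation spheres): touched ONLY through Mazur-type doubles (`stub_mazurDouble`, AC-trivial presentation
`⟨x ∣ x⟩`, a theorem) — general doubles are `¬MM` or have `r ≥ 2` and stay in item 3546 / `stub_residual`.
§5b/§5d: the `S³/Q₈` bisection `X_L ∪_ψ X̄_L` and every `M_p = X_p ∪_{τ_p} X̄_p` ARE Mazur–Mazur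
(`X_p = S¹×D³ ∪ h²`) and DUAL (§5d (d): the transported belt circle is a Heegaard core meeting the belt sphere
once) — the lever holds on the whole computed torsion census. §9e/§12b `crux_iff_three_sectors`: the lever is
silent on `DoubleSector` (parallel horn ⇒ Mazur), speaks on `CorkTwistSector ∩ MM` (symmetric-link corks
`{A•, B⁰}`: `γ₂ = τ(μ_B) = μ_A`, dual on the nose ⇒ E2 / `Σ_P ≅ S⁴`, §13b) and on `NonTwinSector ∩ MM`
(Akbulut–Yildiz / HMP exotic Mazur pairs if their contact structures match, §6 (T2)) — it never concludes
"the halves are diffeomorphic" (the dead round-1 lever `Stub1`, §9c; Hayden arXiv:2003.13681 Thm 1.3).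
§13b: Hayden's `M_H` has natively `r = 2` one-handles — it is in `stub_residual`'s sector unless its lifted
diagrams reduce to Mazur type (TRIAGE-r2-2/3 sharpening, adopted: the line does NOT claim `M_H` through the
Mazur lever; the exchange lemma settles it). §13c/§13d: the `k = 5` witness `Σ(F,F′)` (seam `S³/Q₈`) and the
324 T6 spheres have natively `(1,4,4)` planar halves — residual sector unless the halves are shown to be
`N₋₂(ℝP²)`-type (§5b residual question). Landed Negative lemmas (`Theorems/AcyclicBisectionRigidity/Negative/*`:
LoadBearing, Targets, Transport, DoubleSector, TwinDecomposition, SeamCompatible, RoundTwoLevers,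
HurwitzTypeCount — imported here: LoadBearing; DoubleBisection of crux 4 for the cross-link): none refutes an
instance of a stub below (they certify shielding / costume shape, the twins decomposition and the type-count
kill of lever `T`, which this line does not use). Negatives index `ledger negatives --problem SmoothPoincare4`:
0 (2026-08-16).

RESHAPE s1 (lead prover-line-stmt-SmoothPoincare4-10507-a1-1, 2026-08-16). (i) `stub_propertyR_recognition` now takes
`hM : M ≃ₕ S⁴` (available in the composition; it replaces the `CompactSpace M` instance and the counts of index 0/3/4, which
the proof re-derives) and the four named facts C/R/L/T as leading hypotheses, and is PROVED — it is literally the `c₂ = 1`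
case of the LANDED `ExchangeRecognition.stub_propertyRClosing` (p91206) fed with the LANDED gluing form
`ExchangeRecognition.stub_propertyRGluing` (p94171); the four facts are registered as fact-stubs `stub_factCerf`,
`stub_factPropertyR`, `stub_factLP`, `stub_factTrace` (VERBATIM the sibling skeleton r3's, one debt list for both lines).
(ii) `stub_mazurDouble` additionally receives the ℚ-acyclicity of `W` (the crux datum `hac.1`), so that the LANDED
`ExchangeRecognition.stub_doubleHalfContractible` (p89382) makes `W` contractible inside any proof (Mazur's theorem is
then the remaining content); its unused Stein datum is `_J`. Stub count: 7 (lever, Mazur, residual, four facts).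

RESHAPE s2 (lead a1-1, 2026-08-16, before wave 1). The residual is SPLIT along the landed normal form
(`ExchangeRecognition.stub_steinHandleNormalForm` + `Gompf1998_thm13_indexLE_two_holds`: every half is a balanced
2-handlebody `h⁰ ∪ n h¹ ∪ n h²`): (a) `stub_residualBall` — some half is DISC-TYPE (`HasHandleDecomposition 3 Wᵢ (1,0,0,…)`):
KNOWN modulo the named facts E (Eliashberg 1990 Thm 5.1, fact-stub `stub_factEliashberg`) and C — the half is `𝔻⁴` (Milnor's
disc theorem), the seam is `S³` (landed `LegendrianRKnotRigidity.stub_seam`, no contractibility used), the other half is a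
Stein filling of `S³` hence `𝔻⁴` (E), `M` is a twisted sphere (gluing transport), `≅ S⁴` (C): the route's support item
`SphereSeamStandard` in handle clothing, provable by adapting crux 4's landed `stub_ballHalf` (p78530); it is taken FIRST in the
composition (by symmetry of the crux data for `W₂`); (b) `stub_residualMany` — neither half disc-type and not both `(1,1,1)`: the
genuinely open `r ≥ 2` sector (Hayden's `M_H`, the `k = 5` witness, T6, Gompf's `C(r,s;m)`; = the sibling lever's territory).
The three gluing facts R, L, T are bundled into ONE fact-stub `stub_factsPropertyRGluing` (budget). Stub count: 7 (lever, Mazur,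
residualBall, residualMany, C, E, R∧L∧T); `stub_propertyR_recognition` stays registered and is LANDING (p96087).

RESHAPE s3 (lead a1-1, 2026-08-16, integrating wave 1). LANDED: `stub_propertyR_recognition` (p96087) and `stub_residualBall`
(p96834, wave-1 worker) — both now closed here BY IMPORT of their Theorems modules. `stub_mazurDouble`: the wave-1 worker reduced
it (kernel-checked) to ONE missing published fact, Mazur's theorem `Mazur1961_double_sphere_four` (the double of a compact
contractible `(1,1,1)`-handlebody is `S⁴`: Mazur 1961 / Aitchison–Rubinstein 1984 Lemma 5.4, read verbatim), filed inline
with the landing stub file (p-id in NOTES; relocation to `Literature/Topology/FourManifolds/MazurDouble.lean`); so the stub now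
takes `hMazur` as leading hypothesis and is PROVED (contractibility of `W` from the landed p89382), and the debt is the new
fact-stub `stub_factMazur` (a LOCAL copy of the def lives in this workfile until the Literature module lands; then it is
replaced by the import). The lever is SCOPED: it now also receives `hB : ¬ (disc-type half)` (available in the composition,
which takes the disc sector first) — on a disc-type half the lever's first horn is a theorem (`M ≅ S⁴` by `stub_residualBall`,
and `S⁴` carries a Morse function with a cancelling `2/3` pair, tree `exists_isMorse_sphereFour_twoThree`), so nothing
conjectural is claimed there any more. Stubs: lever, residualMany, facts C, E, R∧L∧T, M (6 sorries).

RESHAPE s4 (lead a1-1, 2026-08-16, integrating the wave-1 `stub-blocked` reply on `stub_residualMany`: "= sibling lever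
`stub_crossCancellation` + item 0377 + item 3546", kernel-checked by the worker). The open residual is RE-ROUTED through the
sibling line, as all three triagers asked ("merge ≈ exchange-recognition; keep one carrier"): the non-double part of the crux
outside the Mazur–Mazur sector goes through the sibling's lever `stub_crossCancellation` (VERBATIM its registered statement,
Lines/exchange_recognition.lean r3 — handed back `promote-stub` by lead a1-0, re-registered here so ONE statement serves both
skeletons), oriented towards a Mazur-type half whenever one exists, then closes by the LANDED `stub_propertyR_recognition`
(`c₂ = 1`) or by `stub_gscClosing` (VERBATIM the sibling's; `c₂ ≥ 2` = item stmt-SmoothPoincare4-0377 `NoohGscStandard`,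
cross-link `gscClosing_of_nooh`); the double part (seam-compatible twins, landed `Negative.isDouble_of_seamCompatible`) goes to
`stub_mazurDouble` when `W₁` is Mazur-type (PROVED mod M — NEW relative to the sibling, which delegates ALL doubles to the open
crux 4) and otherwise to `stub_nonMazurSteinDoubles` (= the sibling's `stub_contractibleSteinDoubles` minus the Mazur type;
cross-links from item 3546 and from the sibling's verbatim statement). Typed census of the CRUX after s4: closed modulo
{lever A `stub_seamPairDichotomy` (MM, non-double, no disc half), lever B `stub_crossCancellation` (non-MM, non-double, no disc
half), item 0377 at `c₂ ≥ 2`, item 3546 for non-Mazur doubles, named facts C, E, R∧L∧T, M}; LANDED: disc sector, `c₂ = 1`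
closing, Mazur doubles (mod M), normal forms, double-half contractibility. Stubs: 8 sorries (2 levers, 2 item-shaped
residuals, 4 fact-stubs).

RESHAPE s5 (lead a1-1, 2026-08-16): `stub_mazurDouble` LANDED (p102612, Theorems/ConvexBisectionAcyclicBisectionRigidityStubMazurDouble.lean)
modulo the Literature fact `Literature.Topology.FourManifolds.Mazur1961_double_sphere_four` (p99832, `MazurDouble.lean`; its REDUCTION to a
counted thickening + rank-one Andrews–Curtis filed as `MazurDoubleReduction.lean`, p103670) — closed here by import, the local copy
of the def deleted; sorry-free cross-link `seamPairDichotomy_of_crossCancellation` (lever A ⇐ lever B). Registered stubs unchanged (8).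

RESHAPE s6 (lead c2, prover-line-stmt-SmoothPoincare4-10507-c2-0, 2026-08-16): THE GSC LEVER. Lever B `stub_crossCancellation` (VERBATIM the
sibling's) quantifies over EVERY balanced normal form `f₂` of `W₂` and demands exactly `n₂(f₂)` surviving 2-handles; its instances with
`n₂ < n₁` (which the s4/s5 composition used whenever exactly one half is Mazur-type) or with a stabilised `f₂` can only hold through a
Generalised-Property-R-type cancellation of `W₁`'s 1-handles by `W₁`'s OWN 2-handles (lead a1-0's orientation caveat,
Lines/exchange-recognition-lever-audit.md) — implausible as a mechanism although, like every lever here, SPC4-implied as typed. It is REPLACED in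
the composition by the strictly weaker, count-free `stub_gscOfNonDouble`: crux data + non-double ⇒ `M` admits a Morse function WITHOUT
critical points of index `1` (geometric simple connectivity; the prover chooses side, normal forms and slides, so cross-seam cancellation in
the balanced orientation is a mechanism for ALL instances). The closing absorbs the lost count by a three-way split on `c₂(F)`: `0` ⇒ twisted
sphere + Cerf (landed `ExchangeRecognition.stub_propertyRClosing_noTwoHandle`), `1` ⇒ Property R (landed `stub_propertyR_recognition`),
`≥ 2` ⇒ `stub_gscClosing` (item 0377). Sorry-free certificates: `gscOfNonDouble_of_crossCancellation` (the verbatim lever B, as hypothesis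
`hL`, implies the GSC lever through the landed Stein normal form — so a proof of the statement a1-0 asked to promote still closes this
skeleton by `exact`), `gscOfNonDouble_of_crux` and `gscOfNonDouble_of_spc4` (the GSC lever is crux-implied — transport of the tree's
`exists_isMorse_sphereFour_twoThree` along `M ≅ S⁴` by `SeamGluing.IsMorse.comp_diffeomorph` — hence SPC4-shielded, now CERTIFIED rather than
asserted; for lever B verbatim this would need births of `n` cancelling pairs, absent from the tree). Lever A `stub_seamPairDichotomy`
(Mazur–Mazur, count-precise) is kept as registered, with its cross-link `A ⇐ B`. Stubs: 8 sorries (levers A and GSC, 2 item-shaped residuals,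
4 fact-stubs); `stub_crossCancellation` is no longer a stub of this skeleton (it survives only as the hypothesis `hL` of the two certificates).

RESHAPE s7 (lead c3, prover-line-stmt-SmoothPoincare4-10507-c3-0, 2026-08-16): STUB BUDGET AND A SMALLER LEVER. (i) Lever A
`stub_seamPairDichotomy` leaves the registered stub set (8 > stubs_max 7): it is REDUNDANT in the s6 composition — its sector
(Mazur–Mazur ∧ non-double ∧ non-disc) lies inside the GSC lever's domain and step (4) closes it through `finish` — and it is implied both by
lever B verbatim (`seamPairDichotomy_of_crossCancellation`) and by the crux (`seamPairDichotomy_of_crux`); its statement is kept VERBATIM as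
the hypothesis `hA` of the sorry-free certificate `mazurMazurSector_of_seamPairDichotomy` (the finer route: on its sector lever A closes the
crux modulo the facts C, R∧L∧T, M with NO appeal to item 0377). (ii) The GSC lever `stub_gscOfNonDouble` is SHRUNK by the hypothesis `hB`
(neither half is disc-type, available at step (4) of the composition): on a disc-type half the lever is a THEOREM, proved here as
`helper_gscOfDiscTypeHalf` / `helper_gscOfDiscTypeHalf'` — glue the one-critical-point function of the disc to the turned-about Stein
2-handlebody function of the other half (`Gompf1998_thm13_indexLE_two_holds`, c1's landed
`SeamGluing.exists_isMorse_of_steinBisection_of_hasHandleDecomposition`): profile `(1, 0, n, n', 1)`, no critical point of index `1`; the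
cross-link `helper_discSector_of_nooh` records the Eliashberg-free closing of the disc sector (modulo C, R∧L∧T and item 0377 instead of E, C).
Stubs: 7 sorries (GSC lever; `stub_gscClosing` = item 0377; `stub_nonMazurSteinDoubles` ⊂ items 3546/3717; fact-stubs C, E, R∧L∧T, M).

RESHAPE s8 (lead c5, prover-line-stmt-SmoothPoincare4-10507-c5-0, 2026-08-16): FACT M INTEGRATED, FACT T REDUCED. (i) The fact-stub M
`stub_factMazur` is CLOSED by import of the tree's discharge `Mazur1961_double_sphere_four_holds` (`MazurDoubleHolds.lean`, p115655, Mazur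
fact seat): the whole MAZUR-DOUBLE horn of the composition (seam-compatible twins with a `(1,1,1)` half ⇒ `M ≅ S⁴`, Stub 3 p102612 + p89382)
is now an unconditional tree theorem. (ii) The trace conjunct T of `stub_factsPropertyRGluing` was driven by c5's wave-1 worker to its
Cerf-free core: landed `FramedTubeDiffeotopy.lean` (p119736: framed-tube uniqueness in `S³` as a diffeotopy), `KnotTraceUniqueness.lean`
(p120239: the trace `X_m(K)` depends only on the knot type and `m`), `PropertyRTraceBridgeReduction.lean` (p120952) and
`PropertyRTraceBridgeOfPropertyR.lean` (p121644/p121767: `exists_framedKnot_of_hasHandleDecomposition_oneZeroOne_of_traceSurgery_of_propertyR` —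
T follows from Property R itself plus the residual P12 "a `(1,0,1)`-handlebody IS the trace of the framed knot read off its passage data",
so the model's unknottedness question is eliminated); the stub stays registered VERBATIM (R and L are research-sized debts with live
programmes). Stubs: 6 sorries (GSC lever; `stub_gscClosing` = item 0377; `stub_nonMazurSteinDoubles` ⊂ items 3546/3717; fact-stubs C, E, R∧L∧T).

RESHAPE s9 (lead c5, 2026-08-16, integrating wave 2): FACT T DISCHARGED MODULO R. c5's wave-2 worker landed the Morse→Kosinski dictionary and
the trace bookkeeping (`HandleSlabSet/HandlePiece/BaseMap/BasePiece/Attachment/Ends/Single`, `OneZeroOneHandlebodyAttachment`, `HandleBoundarySqueeze`,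
`HandleSphereTube`, `OpenEmbeddingBoundaryRestrict`, `AttachmentBoundaryPieces`, `AttachmentBoundarySurgery`, `KnotTraceOfAttachment`,
`PropertyRTraceBridgeOfPropertyRHolds` — p122630 … p126505, all accepted), ending in
`exists_framedKnot_of_hasHandleDecomposition_oneZeroOne_of_propertyR : isUnknot_of_isIntegralSurgery_zero → exists_framedKnot_of_hasHandleDecomposition_oneZeroOne`.
Hence the registered fact-stub `stub_factsPropertyRGluing` SHRINKS from `R ∧ L ∧ T` to `R ∧ L` (same name, new signature, re-registered), and the
composition derives `hT := factTrace_of_propertyR hR`. Fact debts of the skeleton: {C, E, R, L} (was {C, E, R, L, T, M} at s7). Stubs: 6 sorries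
(GSC lever; `stub_gscClosing` = item 0377; `stub_nonMazurSteinDoubles` ⊂ items 3546/3717; fact-stubs C, E, R∧L).

RESHAPE s10 (lead c7, prover-line-stmt-SmoothPoincare4-10507-c7-0, 2026-08-16): FACT C IS CONTAINED IN FACT L — the fact-stub `stub_factCerf` leaves
the registered stub set. The Laudenbach–Poénaru extension fact at `k = 0` (the closed ball `𝔻⁴`, a `1`-handlebody without `1`-handles) is Cerf's
`Γ₄ = 0` in extension form (tree: `cerf_diffeomorph_sphere_three_extends_ball_of_exists_diffeomorph_comp_incl_eq`, `SPC4HandlesImpliesCerf.lean`), and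
the extension form gives the twisted-sphere form by the PROVED reduction `cerf_twistedSphere_four_of_extends'` (`CerfGammaFourProofs.lean`) fed with the
PROVED uniqueness of gluings (`nonempty_diffeomorph_of_isBoundaryGluing_closedBall_of_isManifold`, `GluingProofs.lean`); so `stub_factCerf` is now the
sorry-free derivation `C := cerf(L)` from the L-conjunct of `stub_factsPropertyRGluing`, by the one-line Literature form
`cerf_twistedSphere_four_of_exists_diffeomorph_comp_incl_eq` (append to `SPC4HandlesImpliesCerf.lean`, p127466, ACCEPTED, commit c170f3d234ea). Nothing else changes: C is still what the `c₂ = 0` closing and (with E) the disc sector consume,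
but as a DEBT it is not independent of L, and the registered stub set is meant to be the minimal independent set. Fact debts of the skeleton:
{E, R, L} (L ⊇ C). Stubs: 5 sorries (GSC lever `stub_gscOfNonDouble`; `stub_gscClosing` = item 0377; `stub_nonMazurSteinDoubles` ⊂ items 3546/3717;
fact-stubs E, R∧L). State audit of the seat (c7, 21:30–22:30Z): Disproof gen 5 v18 unchanged since 05:18Z (no `-- Targets` for the s6–s10 stubs),
no consult note, no discharge `_holds` of E / R / L (nor of C) in the tree, no fact claim on them; the GSC lever has no engine beyond the typed
cross-seam cancellation given dual positions (`DualityReduction`, p116776) and is certified crux-sized modulo item 0377 (`helper_reduction_iff_doubleSector`,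
p117673) and implied by item 0378 (`gscOfNonDouble_of_nooh0378`).
-/

noncomputable section

open scoped Manifold ContDiff Topology ContinuousMap
open Set Function
open Literature.Geometry.Symplectic Literature.AlgebraicTopology.SingularHomology CategoryTheory.Limits
open Literature.Topology.FourManifolds

-- The namespace is prescribed by the crux protocol (`Summit.<P>.<Sub>.Cruxes.<Crux>.<Slug>` with
-- `P = Sub = SmoothPoincare4`), hence the duplicated component.
set_option linter.dupNamespace false
set_option linter.unusedVariables false

namespace Summit.SmoothPoincare4.SmoothPoincare4.Cruxes.AcyclicBisectionRigidity.SeamDualityCancellation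

open Summit.SmoothPoincare4.SmoothPoincare4.Theses
open Summit.SmoothPoincare4.SmoothPoincare4.Theorems.AcyclicBisectionRigidity.ExchangeRecognition
  (stub_propertyRClosing stub_propertyRClosing_noTwoHandle stub_propertyRGluing stub_doubleHalfContractible
    stub_steinHandleNormalForm stub_factGompf exists_isMorse_normalForm)
open Summit.SmoothPoincare4.SmoothPoincare4.Theorems.AcyclicBisectionRigidity.SeamGluing
  (IsMorse.comp_diffeomorph criticalSetOfIndex_comp_diffeomorph ncard_criticalSetOfIndex_comp_diffeomorph
    exists_isMorse_of_steinBisection_of_hasHandleDecomposition)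
open Summit.SmoothPoincare4.SmoothPoincare4.Theorems.AcyclicBisectionRigidity.Negative (isDouble_of_seamCompatible)
open Summit.SmoothPoincare4.SmoothPoincare4.Theorems.ContractibleTwistedDoubleStandard.Negative (double_standard_of_crux)
-- the LANDED stubs of this line (Theorems namespace `…Theorems.AcyclicBisectionRigidity.SeamDualityCancellation`)
open Summit.SmoothPoincare4.SmoothPoincare4.Theorems.AcyclicBisectionRigidity renaming
  SeamDualityCancellation.stub_propertyR_recognition → landed_stub_propertyR_recognition,
  SeamDualityCancellation.stub_residualBall → landed_stub_residualBall,
  SeamDualityCancellation.stub_mazurDouble → landed_stub_mazurDouble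
open Literature.Topology.FourManifolds (cerf_twistedSphere_four isUnknot_of_isIntegralSurgery_zero
  exists_diffeomorph_comp_incl_eq exists_framedKnot_of_hasHandleDecomposition_oneZeroOne)
open Literature.Geometry.Symplectic (Eliashberg1990_steinFilling_sphere_three)

/-- Local notation: the round 4-sphere with its Mathlib manifold structure. -/
local notation "𝕊⁴" => (Metric.sphere (0 : EuclideanSpace ℝ (Fin 5)) 1)

/-- Local notation: the model space `ℝ⁴`. -/
local notation "E4" => EuclideanSpace ℝ (Fin 4)

/-! ## Lever A — the seam-pair dichotomy on the Mazur–Mazur sector (reshape s7: no longer a registered stub; kept VERBATIM as the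
hypothesis `hA` of the certificate `mazurMazurSector_of_seamPairDichotomy`) -/

/-- **Lever A (formerly Stub 1 `stub_seamPairDichotomy`; reshape s7: a HYPOTHESIS `hA`, not a stub) and its sector certificate.**
Given lever A (statement VERBATIM the stub registered by leads a1-1/c2, as `hA`) and the named facts C, R, L, T, M, the crux holds on
lever A's sector (both halves Mazur-type, neither disc-type) with NO appeal to item 0377: the DUAL horn closes by the landed
`stub_propertyR_recognition`, the PARALLEL horn by the landed `stub_mazurDouble`. This is the finer route the registered skeleton no
longer carries (its step (4) sends the sector through the GSC lever and `finish`, hence through item 0377 when `c₂ ≥ 2`).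
THE LEVER ITSELF (docstring of the former stub, kept for the record). Data: the crux's, unbundled
(`M ≃ₕ S⁴`; compact Stein domains `(W₁,J₁)`, `(W₂,J₂)`; smooth embeddings `e₁, e₂` covering `M` and meeting
exactly along the images of their boundaries; pushed-forward complex tangencies equal on the seam; both halves
ℚ-acyclic), PLUS the sector hypothesis that each half admits a handle decomposition with exactly one 0-handle,
one 1-handle, one 2-handle and nothing else (`HasHandleDecomposition 3 Wᵢ (1,1,1,0,…)`: Mazur-type corks and
their exotic partners — Akbulut, positron, Akbulut–Yildiz arXiv:1901.00806 Thm 1, Hayden–Mark–Piccirillo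
arXiv:1908.05269 §6.0.1, Oba's `X_n` arXiv:1405.3751 — and the rational balls `X_p = S¹×D³ ∪ h²` of Disproof §5d;
contractibility is NOT assumed, TRIAGE-r2-1). Conclusion: EITHER `M` carries a Morse function with exactly one
critical point of index `0`, `2`, `3`, `4` each and none of index `1`, OR `M` is a double of `W₁`
(`IsDouble b (𝓡 4) M` for some boundary datum `b` of `W₁`).
Intended proof (the card's mechanism, TRIAGE-r2-3's sharpened wording). From `W₁`'s side
`M = h⁰ ∪ h¹ ∪ h²(ℓ₁) ∪ h²(γ₂) ∪ h³ ∪ h⁴`, where `h²(γ₂)` is the 2-handle of `W₂` upside down, attached to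
`Γ = ∂W₁` along the seam knot `γ₂ = (e₁⁻¹e₂)`(belt circle of `W₂`'s 2-handle) with the transported cocore
framing, and `h³ ∪ h⁴` is `W₂`'s `h¹ ∪ h⁰` upside down. SEAM-PAIR DICHOTOMY (the conjectural step): either
(DUAL) there are an isotopy of `γ₂` in `Γ` and a position of it in `∂(h⁰ ∪ h¹) ∖ ν(ℓ₁) ⊂ S¹×S²` meeting some
non-separating 2-sphere of `S¹×S²` transversally once — then `h²(γ₂)`, attached first, cancels `h¹` (Milnor
1965 Thm 5.4 / Gompf–Stipsicz Prop 4.2.9, any framing, any knotting), the other critical points untouched: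
type `(1,0,1,1,1)` (if instead the dual of `W₁`'s 2-handle cancels `W₂`'s 1-handle, read `−F`); or (PARALLEL)
`γ₂` is isotopic in `Γ` to the belt circle `γ₁` of `h²(ℓ₁)` with equal framings — then the 2-handlebody
`W₁ ∪ h²(γ₂)` of `M` is that of `D(W₁)`, `M ≅ D(W₁)` by `nonempty_diffeomorph_of_isBoundaryGluing_twoHandlebody`
(Laudenbach–Poénaru), and `IsDouble` transports along the diffeomorphism (`IsBoundaryGluing.diffeomorph_comp`).
Where `M ≃ₕ S⁴` enters: `π₁ M = 1` forces `γ₂` to generate `π₁ W₁ = ⟨x ∣ x^a⟩` (`a` = winding of `ℓ₁`), i.e.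
`[γ₂]` is a unit mod `a` — ALGEBRAIC duality — and the stub is the geometric upgrade "algebraically dual ⇒ dual
or parallel" (slides over `ℓ₁` change the winding by multiples of `a`, so homology obstructs nothing further,
TRIAGE-r2-1); mismatched parallel framings (slam-dunk: `H₁ = ℤ/|n|`) and `γ₂` inside a 3-ball (`Γ # S³_n(K)`)
are excluded by the handle structure alone, since `∂(W₁ ∪ h²(γ₂)) = ∂(h³ ∪ h⁴) = S¹×S²` is prime with `H₁ = ℤ`
— except when `Γ = S³`, where `ℓ₁ = S¹ × pt` (Property R read in `S¹×S²`) and every `γ₂` is dual after one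
slide over `ℓ₁`; in the torsion sub-sector (`π₁ Wᵢ ≠ 1`) PARALLEL is impossible (`π₁ D(W₁) = π₁ W₁ ≠ 1 = π₁ M`), so the stub
claims DUAL there — true on the whole computed census (Disproof §5d (d): `M_p = X_p ∪_{τ_p} X̄_p`, `w = 1`;
`p = 2` is the `S³/Q₈` bisection of `S⁴`, §5b). Why plausibly true: duality
holds on EVERY known Mazur–Mazur inhabitant (symmetric-link cork twists: `γ₂ = τ(μ_B) = μ_A` links the dotted
circle once, Disproof §13b / evidence E2; `M_p`: §5d (d)); the selection principle behind it is contact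
(card K2 = the line's Transfer, untyped: `γ₁, γ₂` are Legendrian in the tight `(Γ,ξ)` with contact
`(+1)`-surgery the tight `S¹×S²` — Ding–Geiges duality — so the dichotomy is a statement about PAIRS in one
set `𝓜(Γ,ξ)` of tight-`S¹×S²` Legendrians, on which surgery naturality of `c(ξ)`, LOSS invariants and
Legendrian simplicity in `(S¹×S², ξ_std)` act; for `(S³, ξ_std)` it is Property R + Eliashberg–Fraser).
Why it might fail: nothing known FORCES it — a Mazur–Mazur bisection whose `γ₂` wraps `≥ 2` times about
`W₁`'s 1-handle in every position (TRIAGE-r2-1: `≥ 2`, not `≥ 3`; homology gives no parity) and is not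
parallel would leave this stub undecided there (not refuted: the conclusion is still SPC4-implied); first
candidates: Gompf's infinite-order cork twists `f^k` on `C(r,s;m)` (arXiv:1603.05090) if contact-compatible,
Hayden's pairs after reduction to one 1-handle. Size XL (the dichotomy) + L (the typed packaging: glued Morse
function on `M` from adapted Morse functions on the halves, cancellation, Laudenbach–Poénaru transport).
Sources: Gompf–Stipsicz 1999 §4.2/§5.4; Milnor 1965 Thm 5.4 (tree fact
`Cobordism.Milnor1965_firstCancellation_slab`); arXiv:1603.05090; arXiv:2003.13681 §2; arXiv:2107.06856 §2.
RESHAPE s3 (lead a1-1): SCOPED by `hB` — neither half is disc-type (the composition has already sent disc-type halves to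
the landed `stub_residualBall`); this removes the `Γ = S³` sub-case (where the lever is a theorem: `M ≅ S⁴` and `S⁴` carries a
`(1,0,1,1,1)` Morse function, `exists_isMorse_sphereFour_twoThree`) from the conjectural claim. STUCK (no engine; SPC4-implied
as typed); its typed PACKAGING — a Morse function on `M` glued from adapted Morse functions of the halves across the seam,
profile of `W₁` plus the turned-about profile of `W₂` — is NOT in the tree (only the splitting direction is:
`RegularLevelSplitting`, `HandlebodySplitting`; ingredients `SeamFunction.exists_seamFunction`, `LevelSplicingMorse.isMorse_splice`,
`MorseTurnAbout` exist), wave-1 recon. [folklore] -/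
theorem mazurMazurSector_of_seamPairDichotomy
    (hA : ∀ (M : Type) [TopologicalSpace M] [T2Space M] [SecondCountableTopology M] [ChartedSpace E4 M]
      [IsManifold (𝓡 4) ∞ M] (_hM : M ≃ₕ 𝕊⁴)
      (W₁ : Type) [TopologicalSpace W₁] [ChartedSpace (EuclideanHalfSpace 4) W₁] [IsManifold (𝓡∂ 4) ∞ W₁]
      [CompactSpace W₁] (W₂ : Type) [TopologicalSpace W₂] [ChartedSpace (EuclideanHalfSpace 4) W₂]
      [IsManifold (𝓡∂ 4) ∞ W₂] [CompactSpace W₂] (J₁ : SteinStructure W₁) (J₂ : SteinStructure W₂)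
      (e₁ : W₁ → M) (e₂ : W₂ → M)
      (_he₁ : Manifold.IsSmoothEmbedding (𝓡∂ 4) (𝓡 4) ∞ e₁)
      (_he₂ : Manifold.IsSmoothEmbedding (𝓡∂ 4) (𝓡 4) ∞ e₂)
      (_hcover : range e₁ ∪ range e₂ = univ)
      (_hseam₁ : range e₁ ∩ range e₂ = e₁ '' (𝓡∂ 4).boundary W₁)
      (_hseam₂ : range e₁ ∩ range e₂ = e₂ '' (𝓡∂ 4).boundary W₂)
      (_hξ : ∀ w₁ w₂, e₁ w₁ = e₂ w₂ →
        Submodule.map (mfderiv (𝓡∂ 4) (𝓡 4) e₁ w₁).toLinearMap (contactPlane J₁.J w₁) =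
        Submodule.map (mfderiv (𝓡∂ 4) (𝓡 4) e₂ w₂).toLinearMap (contactPlane J₂.J w₂))
      (_hac : ∀ k, 0 < k → IsZero (singularHomology ℚ ℚ W₁ k) ∧ IsZero (singularHomology ℚ ℚ W₂ k))
      (_h₁ : HasHandleDecomposition 3 W₁ (fun k => if k ≤ 2 then 1 else 0))
      (_h₂ : HasHandleDecomposition 3 W₂ (fun k => if k ≤ 2 then 1 else 0))
      (_hB : ¬ (HasHandleDecomposition 3 W₁ (fun k => if k = 0 then 1 else 0) ∨
        HasHandleDecomposition 3 W₂ (fun k => if k = 0 then 1 else 0))),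
      (∃ F : M → ℝ, IsMorse (𝓡 4) F ∧ (criticalSetOfIndex (𝓡 4) F 0).ncard = 1 ∧
          criticalSetOfIndex (𝓡 4) F 1 = ∅ ∧ (criticalSetOfIndex (𝓡 4) F 2).ncard = 1 ∧
          (criticalSetOfIndex (𝓡 4) F 3).ncard = 1 ∧ (criticalSetOfIndex (𝓡 4) F 4).ncard = 1) ∨
        ∃ b : BoundaryData (𝓡∂ 4) W₁ (𝓡 3), IsDouble b (𝓡 4) M)
    (hC : cerf_twistedSphere_four) (hPR : isUnknot_of_isIntegralSurgery_zero)
    (hLP : exists_diffeomorph_comp_incl_eq.{0}) (hT : exists_framedKnot_of_hasHandleDecomposition_oneZeroOne)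
    (hMazur : Mazur1961_double_sphere_four)
    (M : Type) [TopologicalSpace M] [T2Space M] [SecondCountableTopology M] [ChartedSpace E4 M]
    [IsManifold (𝓡 4) ∞ M] (hM : M ≃ₕ 𝕊⁴)
    (W₁ : Type) [TopologicalSpace W₁] [ChartedSpace (EuclideanHalfSpace 4) W₁] [IsManifold (𝓡∂ 4) ∞ W₁]
    [CompactSpace W₁] (W₂ : Type) [TopologicalSpace W₂] [ChartedSpace (EuclideanHalfSpace 4) W₂]
    [IsManifold (𝓡∂ 4) ∞ W₂] [CompactSpace W₂] (J₁ : SteinStructure W₁) (J₂ : SteinStructure W₂)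
    (e₁ : W₁ → M) (e₂ : W₂ → M)
    (he₁ : Manifold.IsSmoothEmbedding (𝓡∂ 4) (𝓡 4) ∞ e₁)
    (he₂ : Manifold.IsSmoothEmbedding (𝓡∂ 4) (𝓡 4) ∞ e₂)
    (hcover : range e₁ ∪ range e₂ = univ)
    (hseam₁ : range e₁ ∩ range e₂ = e₁ '' (𝓡∂ 4).boundary W₁)
    (hseam₂ : range e₁ ∩ range e₂ = e₂ '' (𝓡∂ 4).boundary W₂)
    (hξ : ∀ w₁ w₂, e₁ w₁ = e₂ w₂ →
      Submodule.map (mfderiv (𝓡∂ 4) (𝓡 4) e₁ w₁).toLinearMap (contactPlane J₁.J w₁) =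
      Submodule.map (mfderiv (𝓡∂ 4) (𝓡 4) e₂ w₂).toLinearMap (contactPlane J₂.J w₂))
    (hac : ∀ k, 0 < k → IsZero (singularHomology ℚ ℚ W₁ k) ∧ IsZero (singularHomology ℚ ℚ W₂ k))
    (h₁ : HasHandleDecomposition 3 W₁ (fun k => if k ≤ 2 then 1 else 0))
    (h₂ : HasHandleDecomposition 3 W₂ (fun k => if k ≤ 2 then 1 else 0))
    (hB : ¬ (HasHandleDecomposition 3 W₁ (fun k => if k = 0 then 1 else 0) ∨
      HasHandleDecomposition 3 W₂ (fun k => if k = 0 then 1 else 0))) :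
    Nonempty (M ≃ₘ⟮𝓡 4, 𝓡 4⟯ 𝕊⁴) := by
  haveI : T2Space W₁ := he₁.isEmbedding.t2Space
  haveI : SecondCountableTopology W₁ := he₁.isEmbedding.secondCountableTopology
  rcases hA M hM W₁ W₂ J₁ J₂ e₁ e₂ he₁ he₂ hcover hseam₁ hseam₂ hξ hac h₁ h₂ hB
    with ⟨F, hF, -, h1, h2, -, -⟩ | ⟨b, hD⟩
  · -- DUAL horn: Property R recognition (landed p96087)
    exact landed_stub_propertyR_recognition hC hPR hLP hT M hM F hF h1 h2
  · -- PARALLEL horn: Mazur doubles (landed p102612)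
    exact landed_stub_mazurDouble hMazur W₁ J₁ h₁ (fun k hk => (hac k hk).1) b M hM hD

/-! ## Fact-stubs E, R∧L (and the derived fact C ⊆ L) — the named-fact debt of the known endgames (shared with `exchange-recognition` r3 and crux 4) -/

/-- **Fact-stub E (`stub_factEliashberg`; NAMED-FACT DEBT; reshape s2).** VERBATIM the tree's named fact
`Literature.Geometry.Symplectic.Eliashberg1990_steinFilling_sphere_three` (`SteinFillingSphere.lean`; ELIASHBERG 1990 Thm. 5.1:
a compact Stein domain whose boundary is diffeomorphic to `S³` is diffeomorphic to `𝔻⁴`; partial programme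
`SteinFillingSphere*.lean`). Used by `stub_residualBall`; identical to crux 4's fact-stub E. A discharge `…_holds` closes it by
`exact`. [cite: Eliashberg1990, Thm. 5.1] -/
theorem stub_factEliashberg : Eliashberg1990_steinFilling_sphere_three := by
  sorry

/-- **Fact-stub R∧L (`stub_factsPropertyRGluing`; NAMED-FACT DEBT — reshape s9, lead c5: the conjunct T has LEFT the stub, being a theorem modulo R,
`factTrace_of_propertyR` below; was R∧L∧T, three published theorems bundled, reshape s2).**
The landed gluing form `ExchangeRecognition.stub_propertyRGluing` (p94171) consumes three named facts; two remain debts, VERBATIM: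
(R) `Literature.Topology.FourManifolds.isUnknot_of_isIntegralSurgery_zero` (`SurgeryGluck.lean`; GABAI'S PROPERTY R, Gabai 1987
Cor. 8.3; reduced in-tree to the genus clause + Dehn's lemma, `isUnknot_of_isIntegralSurgery_zero_holds_of`);
(L) `Literature.Topology.FourManifolds.exists_diffeomorph_comp_incl_eq` at universe `0` (`SPC4Handles.lean`; LAUDENBACH–POÉNARU
1972; reduced in-tree by `exists_diffeomorph_comp_incl_eq_holds_of`, genus-1 case open);
the third, (T) `Literature.Topology.FourManifolds.exists_framedKnot_of_hasHandleDecomposition_oneZeroOne` (`PropertyRTraceClosing.lean`; the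
TRACE BRIDGE, Kirby 1989 Ch. I §§1–2, GST 2010 §2), is since reshape s9 a THEOREM modulo (R) (`factTrace_of_propertyR`, tree p126505) and is
derived inside the composition. Discharge = `⟨R_holds, L_holds⟩`, each conjunct independently in Literature. [cite: GabaiJDG1987, Cor. 8.3]
[cite: LaudenbachPoenaruBSMF1972, main theorem] [cite: GompfScharlemannThompson2010, §2] -/
theorem stub_factsPropertyRGluing : isUnknot_of_isIntegralSurgery_zero ∧ exists_diffeomorph_comp_incl_eq.{0} := by
  sorry

/-- The `k = 0` instance of the Laudenbach–Poénaru fact is Cerf's theorem in extension form — adapted verbatim from the tree's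
`cerf_diffeomorph_sphere_three_extends_ball_of_exists_diffeomorph_comp_incl_eq` (`SPC4HandlesImpliesCerf.lean`), restated here only so
that this workfile does not import that module (re-committed by p127466; farm snapshots lag) and elaborates on every snapshot.
[cite: LaudenbachPoenaruBSMF1972, §2, proof of Thm. A, p. 342 (case p = 0)] -/
theorem cerfExtends_of_factLP (hL : exists_diffeomorph_comp_incl_eq.{0}) : cerf_diffeomorph_sphere_three_extends_ball := by
  intro φ
  haveI : Fact (isSmoothEmbedding_sphereInclusion' 3) := ⟨isSmoothEmbedding_sphereInclusion'_holds 3⟩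
  haveI : ConnectedSpace (Metric.closedBall (0 : EuclideanSpace ℝ (Fin 4)) 1) := connectedSpace_closedBall 3
  obtain ⟨Φ, hΦ⟩ := hL (Metric.closedBall (0 : EuclideanSpace ℝ (Fin 4)) 1)
    (isHandlebodyOfIndexLE_closedBall 3 1) (isOrientable_closedBall 3) (closedBallBoundaryData 3) φ
  exact ⟨Φ, fun z => congrFun hΦ z⟩

/-- **Fact C (`stub_factCerf`; DERIVED — reshape s10, lead c7: C ⊆ L; was a registered NAMED-FACT DEBT s1–s9).** VERBATIM the
tree's named fact `Literature.Topology.FourManifolds.cerf_twistedSphere_four` (`CerfGammaFour.lean`; Cerf 1968, `Γ₄ = 0`: every twisted sphere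
`𝔻⁴ ∪_φ 𝔻⁴` is diffeomorphic to `S⁴`). It is CONTAINED in the L-conjunct of `stub_factsPropertyRGluing`: the Laudenbach–Poénaru extension
fact applied to the `1`-handlebody `𝔻⁴` (no `1`-handle) says that every self-diffeomorphism of `S³` extends over `D⁴` — Cerf's theorem in
extension form (tree: `cerf_diffeomorph_sphere_three_extends_ball_of_exists_diffeomorph_comp_incl_eq`, `SPC4HandlesImpliesCerf.lean`,
Laudenbach–Poénaru 1972 proof of Thm. A, p. 342, case `p = 0`) —, and the extension form gives the twisted-sphere form through the PROVED
reduction `cerf_twistedSphere_four_of_extends'` (`CerfGammaFourProofs.lean`: Kuiper's summary in Cerf's book) with the PROVED uniqueness of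
gluings `D⁴ ∪_φ D⁴` (`nonempty_diffeomorph_of_isBoundaryGluing_closedBall_of_isManifold`, `GluingProofs.lean`, Hirsch Thm. 8.2.1). So the
skeleton's `c₂ = 0` closing (`ExchangeRecognition.stub_propertyRClosing_noTwoHandle`), its Property-R endgame and its disc sector keep
consuming `stub_factCerf`, but the registered debt is L alone (the derivation is the tree's
`cerf_twistedSphere_four_of_exists_diffeomorph_comp_incl_eq`, `SPC4HandlesImpliesCerf.lean`, p127466, landed by this seat). A discharge `cerf_twistedSphere_four_holds` would of course also
close it by `exact`, independently of L. [cite: CerfDiffeoSphere1968, Γ₄ = 0] [cite: LaudenbachPoenaruBSMF1972, §2, proof of Thm. A, p. 342] -/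
theorem stub_factCerf : cerf_twistedSphere_four :=
  -- DERIVED (reshape s10, lead c7): C ⊆ L. This term IS the tree's one-liner
  -- `cerf_twistedSphere_four_of_exists_diffeomorph_comp_incl_eq stub_factsPropertyRGluing.2` (`SPC4HandlesImpliesCerf.lean`,
  -- p127466, commit c170f3d234ea), spelled out through its ingredients (`cerfExtends_of_factLP` above, then the PROVED
  -- `cerf_twistedSphere_four_of_extends'` + the PROVED uniqueness of gluings).
  cerf_twistedSphere_four_of_extends' (cerfExtends_of_factLP stub_factsPropertyRGluing.2)
    (fun _ _ _ _ => nonempty_diffeomorph_of_isBoundaryGluing_closedBall_of_isManifold)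

/-- **Fact T is a theorem modulo Property R (reshape s9, lead c5; sorry-free).** The trace bridge
`exists_framedKnot_of_hasHandleDecomposition_oneZeroOne` follows from Gabai's Property R alone, by the tree's
`exists_framedKnot_of_hasHandleDecomposition_oneZeroOne_of_propertyR` (`PropertyRTraceBridgeOfPropertyRHolds.lean`, p126505, landed by
c5's wave 2 on top of wave 1's `…_of_traceSurgery_of_propertyR`, p121767): a Morse `(1,0,1)`-handlebody IS the Kosinski trace
`𝔻⁴ ∪_{(K,n)} h²` of the framed knot read off its passage data (Kosinski VII (2.2), `SlabData.isMultiAttachment_slabSet` /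
`exists_isTrace_of_hasHandleDecomposition_oneZeroOne`), its boundary is `n`-surgery on `K` (Kirby I Lemma 2.1,
`FramedLink.IsTrace.isIntegralSurgery_single`), traces depend only on the framed isotopy class (`KnotTraceUniqueness`), and the
`0`-framed-unknot model inside `S⁴` is certified by Property R applied to the birth-pair lower half of `SphereFourOneZeroOneSplitting`.
So the skeleton's fact debt list is now {C, E, R, L}. [cite: Kosinski1993, VII (2.2)] [cite: Kirby1989, Ch. I Lemma 2.1]
[cite: GompfScharlemannThompson2010, §2] -/
theorem factTrace_of_propertyR (hR : isUnknot_of_isIntegralSurgery_zero) :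
    exists_framedKnot_of_hasHandleDecomposition_oneZeroOne :=
  exists_framedKnot_of_hasHandleDecomposition_oneZeroOne_of_propertyR hR

/-! ## Stub 2 — the Property-R endgame (PROVED, reshape s1: the `c₂ = 1` case of the landed sibling stubs) -/

/-- **Stub 2 (PROPERTY-R RECOGNITION; PROVED modulo the fact-stubs C, R, L, T — reshape s1).** A homotopy 4-sphere `M`
carrying a Morse function with no critical point of index `1` and exactly one of index `2` is diffeomorphic to `S⁴`.
(The planner's form asked for a closed `M` with profile `(1,0,1,1,1)` and no homotopy hypothesis — the handle count forces
the homotopy type on paper; the composition HAS `M ≃ₕ S⁴`, so the reshape feeds it in and drops the now-redundant counts of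
index `0, 3, 4`, which the proof re-derives: one minimum by cancellation, `χ = 2`, turn-about.) Proof: this is the case
`c₂ ≤ 1` of `ExchangeRecognition.stub_propertyRClosing` (LANDED p91206: `M` compact and connected from `M ≃ₕ S⁴`; unique
minimum; self-indexing rearrangement; cut above the 2-handle into the knot trace `P = 𝔻⁴ ∪_K h²` and the
`(1,1)`-handlebody `V`; `c₂ = 0` is a twisted sphere, Cerf) fed with the gluing form `ExchangeRecognition.stub_propertyRGluing`
(LANDED p94171: `S³_n(K) = ∂P ≅ ∂V = S¹ × S²` forces `n = 0`, Gabai's Property R makes `K` the unknot, `P ≅ S² × D²`, and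
`S² × D² ∪_φ S¹ × B³ ≅ S⁴` for every `φ` by Laudenbach–Poénaru — GST 2010 Prop. 9.2, `n = 1`). No barrier (Property (1)R is
a theorem; `StrictPropertyTwoRBarrier` is not touched). Sources: Gabai 1987 Cor 8.3; Laudenbach–Poénaru, Bull. SMF 100
(1972); Cerf 1968; Gompf–Stipsicz 1999 §4.4, §5.4. [cite: GabaiJDG1987, Cor. 8.3] [cite: LaudenbachPoenaruBSMF1972, main theorem]
[cite: CerfDiffeoSphere1968] -/
theorem stub_propertyR_recognition (hC : cerf_twistedSphere_four)
    (hPR : isUnknot_of_isIntegralSurgery_zero) (hLP : exists_diffeomorph_comp_incl_eq.{0})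
    (hT : exists_framedKnot_of_hasHandleDecomposition_oneZeroOne)
    (M : Type) [TopologicalSpace M] [T2Space M] [SecondCountableTopology M] [ChartedSpace E4 M]
    [IsManifold (𝓡 4) ∞ M] (hM : M ≃ₕ 𝕊⁴)
    (F : M → ℝ) (hF : IsMorse (𝓡 4) F) (h1 : criticalSetOfIndex (𝓡 4) F 1 = ∅)
    (h2 : (criticalSetOfIndex (𝓡 4) F 2).ncard = 1) :
    Nonempty (M ≃ₘ⟮𝓡 4, 𝓡 4⟯ 𝕊⁴) :=
  -- LANDED p96087 (Theorems/ConvexBisectionAcyclicBisectionRigidityStubPropertyRRecognition.lean)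
  landed_stub_propertyR_recognition hC hPR hLP hT M hM F hF h1 h2

/-! ## Fact-stub M — Mazur's theorem (DISCHARGED: `Literature.Topology.FourManifolds.Mazur1961_double_sphere_four_holds`, p115655; closed by import, reshape s8) -/

/-- **Fact-stub M (`stub_factMazur`; DISCHARGED — reshape s8, lead c5; was a NAMED-FACT DEBT, reshape s3/s5).** VERBATIM the tree's
named fact `Literature.Topology.FourManifolds.Mazur1961_double_sphere_four` (`MazurDouble.lean`, p99832; Mazur 1961 / Aitchison–Rubinstein 1984
Lemma 5.4: the double of a compact contractible `(1,1,1)`-handlebody is `S⁴`). PROVED in the tree by the Mazur fact seat: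
`Mazur1961_double_sphere_four_holds` (`MazurDoubleHolds.lean`, p115655, 2026-08-16: Mazur's homotopy in the level `V₁₊` of `W × I` —
the attaching circle generates `π₁(V₁₊)`, Milnor 3.14 / van Kampen, so it is homotopic to the ideal circle of Lemma 8.3 or its reverse —,
Whitney + Thm. 5.8 put the `(1, 2)` pair in cancelling position, Thm. 5.4 gives `W × I ≅ B⁵`, and `D(W) = ∂(W × I) ≅ S⁴`). Closed here
by import: the gate refuses a separate `--supports` stub file whose only theorem restates a landed one (`dedup.landed`), so the
integration is this one-line proof; the landed Stub 3 `stub_mazurDouble` (p102612) is now UNCONDITIONAL in `AcyclicBisectionRigidity_of`.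
[cite: AitchisonRubinstein1984, Lemma 5.4] [cite: Mazur1961, Theorem and Corollary] -/
theorem stub_factMazur : Mazur1961_double_sphere_four :=
  -- DISCHARGED in the tree (p115655, `MazurDoubleHolds.lean`); closed here by import (reshape s8, lead c5).
  Mazur1961_double_sphere_four_holds

/-! ## Stub 3 — the parallel horn's endgame: homotopy-sphere doubles of Mazur-type domains (PROVED modulo fact-stub M, reshape s3) -/

/-- **Stub 3 (MAZUR DOUBLES; LANDED p102612 — proved modulo the fact-stub M; reshape s3): if a homotopy 4-sphere `P` is the double
`D(W) = W ∪_id W` (tree predicate `IsDouble`) of a compact ℚ-acyclic 4-manifold `W` admitting a handle decomposition with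
one 0-, one 1-, one 2-handle and nothing else, then `P ≅ S⁴`.** Proof: `W` is CONTRACTIBLE by the landed
`ExchangeRecognition.stub_doubleHalfContractible` (p89382: the fold retraction `D(W) → W` makes `W` a retract of the homotopy
4-sphere `P`, hence simply connected with `H₁ = H₂ = H₃ = 0`; a compact simply connected 4-manifold with connected nonempty
boundary and `H₁ = H₂ = 0` is contractible — Lefschetz duality, Hurewicz, Whitehead), so `W` is a Mazur manifold and Mazur's
theorem (`hMazur`) concludes. In print: `W = S¹×B³ ∪ h²(ℓ)` with `ℓ` homotopic to `±` the generator, isotopic to `S¹ × pt` in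
`∂(S¹×B⁴) = S¹×S³`, so `W × I ≅ B⁵` (Mazur, Ann. of Math. 73 (1961); Akbulut–Kirby, Michigan Math. J. 26 (1979) §1) and
`D(W) ≅ ∂(W × I) ≅ S⁴`; the presentation sphere of `⟨x ∣ x^{±1}⟩`, AC-trivial — the only place where the line touches
`DoubleSector` (Disproof §12). The Stein structure `_J` is carried (the composition has it) but unused. ALTERNATIVELY the stub
follows from the route's rank-4 crux `ContractibleTwistedDoubleStandard` (item stmt-SmoothPoincare4-3546): cross-link
`mazurDouble_of_crux4` below (sorry-free). LANDING: Theorems/ConvexBisectionAcyclicBisectionRigidityStubMazurDouble.lean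
(proposal in NOTES; the inline fact relocates to Literature). [cite: AitchisonRubinstein1984, Lemma 5.4]
[cite: Mazur1961, Theorem and Corollary] -/
theorem stub_mazurDouble (hMazur : Mazur1961_double_sphere_four)
    (W : Type) [TopologicalSpace W] [T2Space W] [SecondCountableTopology W]
    [ChartedSpace (EuclideanHalfSpace 4) W] [IsManifold (𝓡∂ 4) ∞ W] [CompactSpace W]
    (_J : SteinStructure W) (hW : HasHandleDecomposition 3 W (fun k => if k ≤ 2 then 1 else 0))
    (hac : ∀ k, 0 < k → IsZero (singularHomology ℚ ℚ W k))
    (b : BoundaryData (𝓡∂ 4) W (𝓡 3))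
    (P : Type) [TopologicalSpace P] [T2Space P] [SecondCountableTopology P] [ChartedSpace E4 P]
    [IsManifold (𝓡 4) ∞ P] (hP : P ≃ₕ 𝕊⁴) (hD : IsDouble b (𝓡 4) P) :
    Nonempty (P ≃ₘ⟮𝓡 4, 𝓡 4⟯ 𝕊⁴) :=
  -- LANDED p102612 (Theorems/ConvexBisectionAcyclicBisectionRigidityStubMazurDouble.lean)
  landed_stub_mazurDouble hMazur W _J hW hac b P hP hD

/-! ## Stub 4a — a disc-type half: the seam-`S³` sector (KNOWN modulo E and C; reshape s2) -/

/-- **Stub 4a (`stub_residualBall`; LANDED p96834 — known theorem modulo the fact-stubs E and C; reshape s2).** In an acyclic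
common-contact Stein bisection `M = e₁(W₁) ∪ e₂(W₂)` of a homotopy 4-sphere, if the FIRST half is disc-type — it admits a
Morse function adapted to `∂W₁` with exactly one critical point, of index `0` (`HasHandleDecomposition 3 W₁ (1,0,0,…)`) — then
`M ≅ S⁴`. Proof in print / in tree: `W₁ ≅ 𝔻⁴` by Milnor's disc theorem (tree
`nonempty_diffeomorph_closedBall_of_isMorseAdapted_of_isLocalMin`: the unique critical point is the minimum, interior); the seam
map `ψ = incl₂⁻¹ ∘ e₂⁻¹ ∘ e₁ ∘ incl₁` is a diffeomorphism of the abstract boundaries (LANDED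
`ContractibleTwistedDoubleStandard.LegendrianRKnotRigidity.stub_seam`, p73294 — uses neither the cover nor contractibility), so
`∂W₂ ≅ ∂W₁ ≅ S³` and `(W₂, J₂)` is a Stein filling of `S³`, hence `W₂ ≅ 𝔻⁴` (E, `Eliashberg1990_steinFilling_sphere_three`);
`M = W₁ ∪_ψ W₂` is a boundary gluing (pieces `e₁, e₂`, seam equations; `M` compact by
`compactSpace_of_homotopyEquiv_sphere_four_holds`), transported along the two ball diffeomorphisms
(`IsBoundaryGluing.transfer`) it is a twisted sphere `𝔻⁴ ∪_χ 𝔻⁴`, hence `≅ S⁴` (C, `cerf_twistedSphere_four`). TEMPLATE: crux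
4's landed `PropertyRMazurHalves.stub_ballHalf` (Theorems/ConvexBisectionContractibleTwistedDoubleStandardStubBallHalf.lean,
p78530) is this argument verbatim for contractible halves with the ball hypothesis read on `J₁.φ`; here the halves are only
ℚ-acyclic (not needed) and the ball hypothesis is the handle count. This is the route's support item `SphereSeamStandard`
(stmt-SmoothPoincare4-10510) in handle clothing; the composition applies it to `W₂` by the symmetry of the crux data. No barrier
(`TwistedSphereBarrierFour` is used positively: Cerf). Size M. [cite: Eliashberg1990, Thm. 5.1] [cite: CerfDiffeoSphere1968, Γ₄ = 0]
[cite: Milnor1963, Thm. 3.1] -/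
theorem stub_residualBall (hE : Eliashberg1990_steinFilling_sphere_three) (hC : cerf_twistedSphere_four)
    (M : Type) [TopologicalSpace M] [T2Space M] [SecondCountableTopology M] [ChartedSpace E4 M]
    [IsManifold (𝓡 4) ∞ M] (hM : M ≃ₕ 𝕊⁴)
    (W₁ : Type) [TopologicalSpace W₁] [ChartedSpace (EuclideanHalfSpace 4) W₁] [IsManifold (𝓡∂ 4) ∞ W₁]
    [CompactSpace W₁] (W₂ : Type) [TopologicalSpace W₂] [ChartedSpace (EuclideanHalfSpace 4) W₂]
    [IsManifold (𝓡∂ 4) ∞ W₂] [CompactSpace W₂] (J₁ : SteinStructure W₁) (J₂ : SteinStructure W₂)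
    (e₁ : W₁ → M) (e₂ : W₂ → M)
    (he₁ : Manifold.IsSmoothEmbedding (𝓡∂ 4) (𝓡 4) ∞ e₁)
    (he₂ : Manifold.IsSmoothEmbedding (𝓡∂ 4) (𝓡 4) ∞ e₂)
    (hcover : range e₁ ∪ range e₂ = univ)
    (hseam₁ : range e₁ ∩ range e₂ = e₁ '' (𝓡∂ 4).boundary W₁)
    (hseam₂ : range e₁ ∩ range e₂ = e₂ '' (𝓡∂ 4).boundary W₂)
    (hξ : ∀ w₁ w₂, e₁ w₁ = e₂ w₂ →
      Submodule.map (mfderiv (𝓡∂ 4) (𝓡 4) e₁ w₁).toLinearMap (contactPlane J₁.J w₁) =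
      Submodule.map (mfderiv (𝓡∂ 4) (𝓡 4) e₂ w₂).toLinearMap (contactPlane J₂.J w₂))
    (h₁ : HasHandleDecomposition 3 W₁ (fun k => if k = 0 then 1 else 0)) :
    Nonempty (M ≃ₘ⟮𝓡 4, 𝓡 4⟯ 𝕊⁴) :=
  -- LANDED p96834 (wave-1 worker; Theorems/ConvexBisectionAcyclicBisectionRigidityStubResidualBall.lean)
  landed_stub_residualBall hE hC M hM W₁ W₂ J₁ J₂ e₁ e₂ he₁ he₂ hcover hseam₁ hseam₂ hξ h₁

/-! ## Bookkeeping (proved): balanced normal forms versus the handle-count predicates of the case split -/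

section Bookkeeping

variable {W : Type} [TopologicalSpace W] [ChartedSpace (EuclideanHalfSpace 4) W] [IsManifold (𝓡∂ 4) ∞ W]
  [CompactSpace W]

/-- In a normal form with indices `≤ 2` there are no critical points of index `≥ 3` (finiteness of the critical set,
`IsMorse.finite_criticalSet_holds`). [folklore] -/
theorem ncard_criticalSetOfIndex_eq_zero_of_indexLE_two {f : W → ℝ} (hf : IsMorseAdapted (𝓡∂ 4) f)
    (hfi : ∀ z, IsMCriticalPt (𝓡∂ 4) f z → morseIndex (𝓡∂ 4) f z ≤ 2) {k : ℕ} (hk : 3 ≤ k) :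
    (criticalSetOfIndex (𝓡∂ 4) f k).ncard = 0 := by
  have hfin : (criticalSetOfIndex (𝓡∂ 4) f k).Finite :=
    (IsMorse.finite_criticalSet_holds hf.isMorse).subset (criticalSetOfIndex_subset _ f k)
  rw [Set.ncard_eq_zero hfin]
  refine Set.eq_empty_of_forall_notMem fun x hx => ?_
  have hle := hfi x hx.1
  rw [hx.2] at hle
  omega

/-- **A balanced normal form with NO 1-handle is a disc-type handle decomposition `(1, 0, 0, …)`** (wave-1 worker). [folklore] -/
theorem hasHandleDecomposition_discType_of_normalForm {f : W → ℝ} (hf : IsMorseAdapted (𝓡∂ 4) f)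
    (hfi : ∀ z, IsMCriticalPt (𝓡∂ 4) f z → morseIndex (𝓡∂ 4) f z ≤ 2)
    (hf0 : (criticalSetOfIndex (𝓡∂ 4) f 0).ncard = 1)
    (hfb : (criticalSetOfIndex (𝓡∂ 4) f 1).ncard = (criticalSetOfIndex (𝓡∂ 4) f 2).ncard)
    (hn : (criticalSetOfIndex (𝓡∂ 4) f 1).ncard = 0) :
    HasHandleDecomposition 3 W (fun k => if k = 0 then 1 else 0) := by
  refine ⟨f, hf, fun k => ?_⟩
  match k with
  | 0 => simpa using hf0
  | 1 => simpa using hn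
  | 2 => simpa using hfb.symm.trans hn
  | k + 3 => simpa using ncard_criticalSetOfIndex_eq_zero_of_indexLE_two hf hfi (k := k + 3) (by omega)

/-- **A balanced normal form with ONE 1-handle is a Mazur-type handle decomposition `(1, 1, 1, 0, …)`** (wave-1 worker).
[folklore] -/
theorem hasHandleDecomposition_mazurType_of_normalForm {f : W → ℝ} (hf : IsMorseAdapted (𝓡∂ 4) f)
    (hfi : ∀ z, IsMCriticalPt (𝓡∂ 4) f z → morseIndex (𝓡∂ 4) f z ≤ 2)
    (hf0 : (criticalSetOfIndex (𝓡∂ 4) f 0).ncard = 1)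
    (hfb : (criticalSetOfIndex (𝓡∂ 4) f 1).ncard = (criticalSetOfIndex (𝓡∂ 4) f 2).ncard)
    (hn : (criticalSetOfIndex (𝓡∂ 4) f 1).ncard = 1) :
    HasHandleDecomposition 3 W (fun k => if k ≤ 2 then 1 else 0) := by
  refine ⟨f, hf, fun k => ?_⟩
  match k with
  | 0 => simpa using hf0
  | 1 => simpa using hn
  | 2 => simpa using hfb.symm.trans hn
  | k + 3 => simpa using ncard_criticalSetOfIndex_eq_zero_of_indexLE_two hf hfi (k := k + 3) (by omega)

/-- **Conversely, a Mazur-type handle decomposition IS a balanced normal form with one 1-handle** (the shape consumed by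
the sibling lever `stub_crossCancellation`): indices `≤ 2` because the counts vanish from index `3` on. [folklore] -/
theorem exists_normalForm_of_hasHandleDecomposition_mazurType
    (h : HasHandleDecomposition 3 W (fun k => if k ≤ 2 then 1 else 0)) :
    ∃ f : W → ℝ, IsMorseAdapted (𝓡∂ 4) f ∧ (∀ z, IsMCriticalPt (𝓡∂ 4) f z → morseIndex (𝓡∂ 4) f z ≤ 2) ∧
      (criticalSetOfIndex (𝓡∂ 4) f 0).ncard = 1 ∧
      (criticalSetOfIndex (𝓡∂ 4) f 1).ncard = (criticalSetOfIndex (𝓡∂ 4) f 2).ncard ∧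
      (criticalSetOfIndex (𝓡∂ 4) f 1).ncard = 1 := by
  obtain ⟨f, hf, hc⟩ := h
  refine ⟨f, hf, fun z hz => ?_, by simpa using hc 0, ?_, by simpa using hc 1⟩
  · by_contra hlt
    rw [not_le] at hlt
    have hfin : (criticalSetOfIndex (𝓡∂ 4) f (morseIndex (𝓡∂ 4) f z)).Finite :=
      (IsMorse.finite_criticalSet_holds hf.isMorse).subset (criticalSetOfIndex_subset _ f _)
    have h0 : (criticalSetOfIndex (𝓡∂ 4) f (morseIndex (𝓡∂ 4) f z)).ncard = 0 := by
      rw [hc]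
      show (if morseIndex (𝓡∂ 4) f z ≤ 2 then 1 else 0) = 0
      rw [if_neg (not_le.mpr hlt)]
    rw [Set.ncard_eq_zero hfin] at h0
    have hz' : z ∈ criticalSetOfIndex (𝓡∂ 4) f (morseIndex (𝓡∂ 4) f z) := ⟨hz, rfl⟩
    rw [h0] at hz'
    exact hz'
  · have h1 : (criticalSetOfIndex (𝓡∂ 4) f 1).ncard = 1 := by simpa using hc 1
    have h2 : (criticalSetOfIndex (𝓡∂ 4) f 2).ncard = 1 := by simpa using hc 2
    rw [h1, h2]

end Bookkeeping

/-! ## Stub 5 — THE GSC LEVER (reshape s6, lead c2): non-double acyclic Stein bisections are geometrically simply connected -/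

/-- **Stub 5 (`stub_gscOfNonDouble`; THE GSC LEVER — reshape s6; XL; SPC4-implied as typed, CERTIFIED below by
`gscOfNonDouble_of_crux` / `gscOfNonDouble_of_spc4`).** Under the crux data (`M ≃ₕ S⁴`; compact Stein halves `(W₁,J₁)`, `(W₂,J₂)`
smoothly embedded, covering `M` and meeting exactly along the images of their boundaries; matched complex tangencies on the seam; both
halves ℚ-acyclic in positive degrees) and the NON-DOUBLE hypothesis (the seam identification extends to no diffeomorphism `W₁ → W₂`),
`M` is GEOMETRICALLY SIMPLY CONNECTED: it carries a Morse function without critical points of index `1`. This is the "homotopy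
4-spheres are geometrically simply connected" conjecture (Kirby 1997, Problem 4.18 neighbourhood; Gompf–Scharlemann–Thompson 2010 §9)
RESTRICTED to the crux class minus doubles, and it is what cross-seam cancellation delivers when it works: glue a balanced Stein normal
form `f₁` of `W₁` (`h⁰ ∪ n₁ h¹ ∪ n₁ h²`, landed `ExchangeRecognition.stub_steinHandleNormalForm`) to the turned-about normal form of `W₂`
across the seam (landed `SeamGluing.exists_isMorse_of_steinBisection_of_hasHandleDecomposition`, profile `(1; n₁; n₁ + n₂; n₂; 1)` read
from `W₁`'s side, lead c1), choose the side with `n₁ ≤ n₂` essential 1-handles, and cancel each of its 1-handles against one of the `n₂`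
2-handles coming from the other half — the 2-handles of `W₂` turned upside down, attached to `Γ = ∂W₁` along the transported Legendrian
duals (belt circles) of `W₂`'s Weinstein 2-handles — once these are slid into GEOMETRICALLY DUAL position (Milnor 1965 Def. 5.1: the
transported dual meets the belt sphere of the 1-handle in one point, transversely, in the intermediate level; the cancellation itself is
the tree theorem `Cobordism.Milnor1965_firstCancellation_slab_holds`, packaged in any index by `CancelPair.cancel_pair_of_isTransverseInLevel`,
lead c1). CONJECTURAL CONTENT = the existence of the dual positions (typed by c1 as the hypothesis `hD` of `DualityReduction`); everything
else is landed packaging. DIFFERENCE FROM LEVER B VERBATIM (`ExchangeRecognition.stub_crossCancellation`, kept below only as the hypothesis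
`hL` of `gscOfNonDouble_of_crossCancellation`, which PROVES this stub from it): no normal form is an input and no 2-handle count is an
output, so the implausible instances of lever B (orientation `n₂ < n₁`, stabilised `f₂` — lead a1-0's audit) are not instances of this
statement; the composition recovers what it needs by splitting on the number `c₂` of index-2 points of the delivered `F` (`0`: Cerf;
`1`: Property R; `≥ 2`: item 0377). Evidence (all balanced, all cancel): exchange / dot-swap pairs — Hayden's non-twin inhabitant `M_H`
and the symmetric-link cork twists (Disproof §13b, evidence E2), the rational Mazur family `X_p ∪_{τ_p} X̄_p` (§5d (d), `w = 1`), the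
shellable planar pairs of §13c–d. Why it might fail: transported duals with wrapping number `≥ 2` about a 1-handle in every slid position
(first candidates: Gompf's infinite-order cork twists `f^k` on `C(r,s;m)`, arXiv:1603.05090, IF contact-compatible); as typed the stub is
refutable only by an exotic `S⁴` (certificate `gscOfNonDouble_of_spc4`). Where `M ≃ₕ S⁴` enters: `π₁ M = 1` makes the transported duals
ALGEBRAICALLY dual after slides (they normally generate `π₁ W₁`); the stub is the geometric upgrade. Barrier:
`Literature.Barriers.SmoothPoincare4.StrictPropertyTwoRBarrier` is NOT touched here (it bites in the closing at `c₂ ≥ 2`, item 0377);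
no Andrews–Curtis content either, because doubles (where cross-seam duals are 0-framed meridians and cancellation IS an AC problem) are
excluded by `hnd` and routed to `stub_mazurDouble` / `stub_nonMazurSteinDoubles`. Size XL.
RESHAPE s7 (lead c3): SCOPED by `hB` — neither half is disc-type. On a disc-type half the conclusion is a THEOREM
(`helper_gscOfDiscTypeHalf` / `helper_gscOfDiscTypeHalf'` below: the glued profile `(1, 0, n, n', 1)` of the disc and the turned-about Stein
2-handlebody of the other half has no index-1 point), and the composition reaches this stub only after its disc case split, so the
hypothesis costs nothing and removes the one sub-sector where nothing conjectural was being claimed. The registered lever is now: crux data +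
non-double + non-disc ⇒ geometrically simply connected. [cite: GompfStipsicz1999, §5.4 and Prop. 4.2.9]
[cite: MilnorHCobordism1965, Thm. 5.4] [cite: DingGeiges2004, §3] [cite: Kirby1997, Problem 4.18] -/
theorem stub_gscOfNonDouble
    (M : Type) [TopologicalSpace M] [T2Space M] [SecondCountableTopology M] [ChartedSpace (EuclideanSpace ℝ (Fin 4)) M]
    [IsManifold (𝓡 4) ∞ M] (hM : M ≃ₕ Metric.sphere (0 : EuclideanSpace ℝ (Fin 5)) 1)
    (W₁ : Type) [TopologicalSpace W₁] [ChartedSpace (EuclideanHalfSpace 4) W₁] [IsManifold (𝓡∂ 4) ∞ W₁]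
    [CompactSpace W₁] (W₂ : Type) [TopologicalSpace W₂] [ChartedSpace (EuclideanHalfSpace 4) W₂]
    [IsManifold (𝓡∂ 4) ∞ W₂] [CompactSpace W₂] (J₁ : SteinStructure W₁) (J₂ : SteinStructure W₂)
    (e₁ : W₁ → M) (e₂ : W₂ → M)
    (he₁ : Manifold.IsSmoothEmbedding (𝓡∂ 4) (𝓡 4) ∞ e₁)
    (he₂ : Manifold.IsSmoothEmbedding (𝓡∂ 4) (𝓡 4) ∞ e₂)
    (hcover : range e₁ ∪ range e₂ = univ)
    (hseam₁ : range e₁ ∩ range e₂ = e₁ '' (𝓡∂ 4).boundary W₁)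
    (hseam₂ : range e₁ ∩ range e₂ = e₂ '' (𝓡∂ 4).boundary W₂)
    (hξ : ∀ w₁ w₂, e₁ w₁ = e₂ w₂ →
      Submodule.map (mfderiv (𝓡∂ 4) (𝓡 4) e₁ w₁).toLinearMap (contactPlane J₁.J w₁) =
      Submodule.map (mfderiv (𝓡∂ 4) (𝓡 4) e₂ w₂).toLinearMap (contactPlane J₂.J w₂))
    (hac : ∀ k, 0 < k → IsZero (singularHomology ℚ ℚ W₁ k) ∧ IsZero (singularHomology ℚ ℚ W₂ k))
    (hnd : ¬ ∃ Φ : W₁ ≃ₘ⟮𝓡∂ 4, 𝓡∂ 4⟯ W₂, ∀ w, w ∈ (𝓡∂ 4).boundary W₁ → e₂ (Φ w) = e₁ w)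
    (hB : ¬ (HasHandleDecomposition 3 W₁ (fun k => if k = 0 then 1 else 0) ∨
      HasHandleDecomposition 3 W₂ (fun k => if k = 0 then 1 else 0))) :
    ∃ F : M → ℝ, IsMorse (𝓡 4) F ∧ criticalSetOfIndex (𝓡 4) F 1 = ∅ := by
  sorry

/-- **The GSC lever follows from item stmt-SmoothPoincare4-0378 `NoOneHandles.NoohNoOneHandles`** (Kirby Problem 4.18 for homotopy
4-spheres: EVERY homotopy 4-sphere carries a Morse function without index-1 critical points; route `NoOneHandles`, crux rank 3, open).
Package `M` — compact and orientable by the PROVED `compactSpace_of_homotopyEquiv_sphere_four_holds` /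
`isOrientable_of_homotopyEquiv_sphere_four_holds` — as a `HomotopySphere 4` and apply the item; none of the bisection data is used. So the
lever is `blocked-on: stmt-SmoothPoincare4-0378` in the ledger's sense (exactly as `stub_gscClosing` is blocked on 0377), and the statement
to PROMOTE is the RESTRICTION of item 0378 to the crux class minus doubles and disc-type halves — the part of Kirby 4.18 for which the line
has a mechanism (cross-seam cancellation of Stein 1-handles against transported Weinstein duals). With this cross-link the non-double
sector of the crux is formally downstream of route `NoOneHandles` (items 0378, 0377) plus the facts C, R, L, T; the double sector of item
3546 plus the fact M. (reshape s7 cross-link, lead c3, sorry-free.) [cite: Kirby1997, Problem 4.18] -/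
theorem gscOfNonDouble_of_nooh0378 (h : NoOneHandles.NoohNoOneHandles)
    (M : Type) [TopologicalSpace M] [T2Space M] [SecondCountableTopology M] [ChartedSpace (EuclideanSpace ℝ (Fin 4)) M]
    [IsManifold (𝓡 4) ∞ M] (hM : M ≃ₕ Metric.sphere (0 : EuclideanSpace ℝ (Fin 5)) 1)
    (W₁ : Type) [TopologicalSpace W₁] [ChartedSpace (EuclideanHalfSpace 4) W₁] [IsManifold (𝓡∂ 4) ∞ W₁]
    [CompactSpace W₁] (W₂ : Type) [TopologicalSpace W₂] [ChartedSpace (EuclideanHalfSpace 4) W₂]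
    [IsManifold (𝓡∂ 4) ∞ W₂] [CompactSpace W₂] (J₁ : SteinStructure W₁) (J₂ : SteinStructure W₂)
    (e₁ : W₁ → M) (e₂ : W₂ → M)
    (_he₁ : Manifold.IsSmoothEmbedding (𝓡∂ 4) (𝓡 4) ∞ e₁)
    (_he₂ : Manifold.IsSmoothEmbedding (𝓡∂ 4) (𝓡 4) ∞ e₂)
    (_hcover : range e₁ ∪ range e₂ = univ)
    (_hseam₁ : range e₁ ∩ range e₂ = e₁ '' (𝓡∂ 4).boundary W₁)
    (_hseam₂ : range e₁ ∩ range e₂ = e₂ '' (𝓡∂ 4).boundary W₂)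
    (_hξ : ∀ w₁ w₂, e₁ w₁ = e₂ w₂ →
      Submodule.map (mfderiv (𝓡∂ 4) (𝓡 4) e₁ w₁).toLinearMap (contactPlane J₁.J w₁) =
      Submodule.map (mfderiv (𝓡∂ 4) (𝓡 4) e₂ w₂).toLinearMap (contactPlane J₂.J w₂))
    (_hac : ∀ k, 0 < k → IsZero (singularHomology ℚ ℚ W₁ k) ∧ IsZero (singularHomology ℚ ℚ W₂ k))
    (_hnd : ¬ ∃ Φ : W₁ ≃ₘ⟮𝓡∂ 4, 𝓡∂ 4⟯ W₂, ∀ w, w ∈ (𝓡∂ 4).boundary W₁ → e₂ (Φ w) = e₁ w)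
    (_hB : ¬ (HasHandleDecomposition 3 W₁ (fun k => if k = 0 then 1 else 0) ∨
      HasHandleDecomposition 3 W₂ (fun k => if k = 0 then 1 else 0))) :
    ∃ F : M → ℝ, IsMorse (𝓡 4) F ∧ criticalSetOfIndex (𝓡 4) F 1 = ∅ := by
  haveI : CompactSpace M := compactSpace_of_homotopyEquiv_sphere_four_holds M hM
  obtain ⟨o⟩ := isOrientable_of_homotopyEquiv_sphere_four_holds M hM
  exact h ⟨M, o, ⟨hM⟩⟩

/-! ## The disc sub-sector of the GSC lever is a theorem (reshape s7, lead c3; PROVED) -/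

/-- **GSC on a disc-type FIRST half (reshape s7; proved).** Under the crux data WITHOUT the acyclicity conjunct, if `W₁` admits a
handle decomposition with a single handle, of index `0` (`HasHandleDecomposition 3 W₁ (1,0,0,…)`), then `M` carries a Morse function
without critical points of index `1`. Proof: the other half is a compact Stein domain, hence a 2-handlebody (Gompf 1998 Thm. 1.3 (a),
the tree's `Gompf1998_thm13_indexLE_two_holds`): an adapted Morse function `f₂` with all indices `≤ 2`, i.e. a handle decomposition
with counts `c₂ k = #Crit_k(f₂)` and `c₂ 3 = 0`; gluing the one-critical-point function of `W₁` to the turned-about `f₂` across the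
seam (c1's landed `SeamGluing.exists_isMorse_of_steinBisection_of_hasHandleDecomposition`) gives a Morse function on `M` with
`#Crit_1 = c₁ 1 + c₂ 3 = 0 + 0`. So the GSC lever's disc sub-sector carries no conjectural content, which is why the registered
lever now assumes `hB`. [cite: Gompf1998, Thm. 1.3 (a)] [cite: MilnorHCobordism1965, §1 and proof of Thm. 3.4] -/
theorem helper_gscOfDiscTypeHalf
    (M : Type) [TopologicalSpace M] [T2Space M] [SecondCountableTopology M] [ChartedSpace (EuclideanSpace ℝ (Fin 4)) M]
    [IsManifold (𝓡 4) ∞ M] (hM : M ≃ₕ Metric.sphere (0 : EuclideanSpace ℝ (Fin 5)) 1)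
    (W₁ : Type) [TopologicalSpace W₁] [ChartedSpace (EuclideanHalfSpace 4) W₁] [IsManifold (𝓡∂ 4) ∞ W₁]
    [CompactSpace W₁] (W₂ : Type) [TopologicalSpace W₂] [ChartedSpace (EuclideanHalfSpace 4) W₂]
    [IsManifold (𝓡∂ 4) ∞ W₂] [CompactSpace W₂] (J₁ : SteinStructure W₁) (J₂ : SteinStructure W₂)
    (e₁ : W₁ → M) (e₂ : W₂ → M)
    (he₁ : Manifold.IsSmoothEmbedding (𝓡∂ 4) (𝓡 4) ∞ e₁)
    (he₂ : Manifold.IsSmoothEmbedding (𝓡∂ 4) (𝓡 4) ∞ e₂)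
    (hcover : range e₁ ∪ range e₂ = univ)
    (hseam₁ : range e₁ ∩ range e₂ = e₁ '' (𝓡∂ 4).boundary W₁)
    (hseam₂ : range e₁ ∩ range e₂ = e₂ '' (𝓡∂ 4).boundary W₂)
    (hξ : ∀ w₁ w₂, e₁ w₁ = e₂ w₂ →
      Submodule.map (mfderiv (𝓡∂ 4) (𝓡 4) e₁ w₁).toLinearMap (contactPlane J₁.J w₁) =
      Submodule.map (mfderiv (𝓡∂ 4) (𝓡 4) e₂ w₂).toLinearMap (contactPlane J₂.J w₂))
    (h₁ : HasHandleDecomposition 3 W₁ (fun k => if k = 0 then 1 else 0)) :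
    ∃ F : M → ℝ, IsMorse (𝓡 4) F ∧ criticalSetOfIndex (𝓡 4) F 1 = ∅ := by
  haveI : CompactSpace M := compactSpace_of_homotopyEquiv_sphere_four_holds M hM
  haveI : T2Space W₂ := he₂.isEmbedding.t2Space
  haveI : SecondCountableTopology W₂ := he₂.isEmbedding.secondCountableTopology
  -- the Stein half `W₂` is a 2-handlebody: an adapted Morse function with indices `≤ 2`
  obtain ⟨f₂, hf₂, hf₂i⟩ := Gompf1998_thm13_indexLE_two_holds.of_steinStructure W₂ J₂
  have hf₂' : IsMorseAdapted (𝓡∂ 4) f₂ := hf₂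
  have h₂ : HasHandleDecomposition 3 W₂ (fun k => (criticalSetOfIndex (𝓡∂ 4) f₂ k).ncard) :=
    ⟨f₂, hf₂', fun _ => rfl⟩
  have h₂3 : (criticalSetOfIndex (𝓡∂ 4) f₂ 3).ncard = 0 := by
    have hfin : (criticalSetOfIndex (𝓡∂ 4) f₂ 3).Finite :=
      (IsMorse.finite_criticalSet_holds hf₂'.isMorse).subset (criticalSetOfIndex_subset _ f₂ 3)
    rw [Set.ncard_eq_zero hfin]
    refine Set.eq_empty_of_forall_notMem fun x hx => ?_
    have hle : morseIndex (𝓡∂ 4) f₂ x ≤ 2 := hf₂i x hx.1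
    rw [hx.2] at hle
    omega
  -- glue across the seam: `#Crit_1 = c₁ 1 + c₂ 3 = 0`
  obtain ⟨F, hF, hcount⟩ := exists_isMorse_of_steinBisection_of_hasHandleDecomposition M hM W₁ W₂ J₁ J₂ e₁ e₂
    he₁ he₂ hcover hseam₁ hseam₂ hξ h₁ h₂
  have h1 : (criticalSetOfIndex (𝓡 4) F 1).ncard = 0 := by
    rw [hcount 1 3 rfl, h₂3]
    simp
  have hfin1 : (criticalSetOfIndex (𝓡 4) F 1).Finite :=
    (IsMorse.finite_criticalSet_holds hF).subset (criticalSetOfIndex_subset _ F 1)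
  exact ⟨F, hF, (Set.ncard_eq_zero hfin1).1 h1⟩

/-- **GSC on a disc-type SECOND half (reshape s7; proved)**: the crux data is symmetric in the two halves, so
`helper_gscOfDiscTypeHalf` applies with the roles of `W₁`, `W₂` exchanged. [folklore] -/
theorem helper_gscOfDiscTypeHalf'
    (M : Type) [TopologicalSpace M] [T2Space M] [SecondCountableTopology M] [ChartedSpace (EuclideanSpace ℝ (Fin 4)) M]
    [IsManifold (𝓡 4) ∞ M] (hM : M ≃ₕ Metric.sphere (0 : EuclideanSpace ℝ (Fin 5)) 1)
    (W₁ : Type) [TopologicalSpace W₁] [ChartedSpace (EuclideanHalfSpace 4) W₁] [IsManifold (𝓡∂ 4) ∞ W₁]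
    [CompactSpace W₁] (W₂ : Type) [TopologicalSpace W₂] [ChartedSpace (EuclideanHalfSpace 4) W₂]
    [IsManifold (𝓡∂ 4) ∞ W₂] [CompactSpace W₂] (J₁ : SteinStructure W₁) (J₂ : SteinStructure W₂)
    (e₁ : W₁ → M) (e₂ : W₂ → M)
    (he₁ : Manifold.IsSmoothEmbedding (𝓡∂ 4) (𝓡 4) ∞ e₁)
    (he₂ : Manifold.IsSmoothEmbedding (𝓡∂ 4) (𝓡 4) ∞ e₂)
    (hcover : range e₁ ∪ range e₂ = univ)
    (hseam₁ : range e₁ ∩ range e₂ = e₁ '' (𝓡∂ 4).boundary W₁)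
    (hseam₂ : range e₁ ∩ range e₂ = e₂ '' (𝓡∂ 4).boundary W₂)
    (hξ : ∀ w₁ w₂, e₁ w₁ = e₂ w₂ →
      Submodule.map (mfderiv (𝓡∂ 4) (𝓡 4) e₁ w₁).toLinearMap (contactPlane J₁.J w₁) =
      Submodule.map (mfderiv (𝓡∂ 4) (𝓡 4) e₂ w₂).toLinearMap (contactPlane J₂.J w₂))
    (h₂ : HasHandleDecomposition 3 W₂ (fun k => if k = 0 then 1 else 0)) :
    ∃ F : M → ℝ, IsMorse (𝓡 4) F ∧ criticalSetOfIndex (𝓡 4) F 1 = ∅ := by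
  have hcover' : range e₂ ∪ range e₁ = univ := by rw [union_comm]; exact hcover
  have hseam₁' : range e₂ ∩ range e₁ = e₂ '' (𝓡∂ 4).boundary W₂ := by rw [inter_comm]; exact hseam₂
  have hseam₂' : range e₂ ∩ range e₁ = e₁ '' (𝓡∂ 4).boundary W₁ := by rw [inter_comm]; exact hseam₁
  have hξ' : ∀ w₂ w₁, e₂ w₂ = e₁ w₁ →
      Submodule.map (mfderiv (𝓡∂ 4) (𝓡 4) e₂ w₂).toLinearMap (contactPlane J₂.J w₂) =
      Submodule.map (mfderiv (𝓡∂ 4) (𝓡 4) e₁ w₁).toLinearMap (contactPlane J₁.J w₁) :=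
    fun w₂ w₁ h => (hξ w₁ w₂ h.symm).symm
  exact helper_gscOfDiscTypeHalf M hM W₂ W₁ J₂ J₁ e₂ e₁ he₂ he₁ hcover' hseam₁' hseam₂' hξ' h₂

/-! ## Stub 6 — closing with ≥ 2 surviving 2-handles (VERBATIM the sibling's `stub_gscClosing`; = item stmt-SmoothPoincare4-0377) -/

/-- **Stub 6 (`stub_gscClosing`; OPEN residual, VERBATIM the sibling's — reshape s4; open-problem).** A homotopy 4-sphere
carrying a Morse function without index-1 critical points and with AT LEAST TWO index-2 critical points is `S⁴`: Weak
Generalised Property R (Gompf–Scharlemann–Thompson 2010 Prop. 9.2) = item stmt-SmoothPoincare4-0377 `NoOneHandles.NoohGscStandard`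
in unbundled form restricted to `c₂ ≥ 2`; the cross-link `gscClosing_of_nooh` below derives it from that item BY NAME, so it is
`blocked-on: stmt-SmoothPoincare4-0377` in the ledger's sense. Barrier: `Literature.Barriers.SmoothPoincare4.StrictPropertyTwoRBarrier`
bites exactly here. SPC4-implied, refutable only by an exotic `S⁴`. [cite: GompfScharlemannThompson2010, Prop. 9.2]
[cite: Kirby1997, Problems 4.18 and 1.82] -/
theorem stub_gscClosing
    (M : Type) [TopologicalSpace M] [T2Space M] [SecondCountableTopology M] [ChartedSpace E4 M]
    [IsManifold (𝓡 4) ∞ M] (hM : M ≃ₕ 𝕊⁴)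
    (F : M → ℝ) (hF : IsMorse (𝓡 4) F) (h1 : criticalSetOfIndex (𝓡 4) F 1 = ∅)
    (h2 : 1 < (criticalSetOfIndex (𝓡 4) F 2).ncard) :
    Nonempty (M ≃ₘ⟮𝓡 4, 𝓡 4⟯ 𝕊⁴) := by
  sorry

/-! ## Stub 7 — non-Mazur doubles of contractible Stein domains (OPEN residual of the double sector; ⊂ item 3546 / 3717) -/

/-- **Stub 7 (`stub_nonMazurSteinDoubles`; OPEN residual — reshape s4; open-problem).** Every (Hausdorff, second countable,
smooth) homotopy-sphere double `P = W ∪_id W` of a compact CONTRACTIBLE Stein domain `(W, S)` which admits NO Mazur-type handle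
decomposition `(1,1,1)` and no disc-type one is diffeomorphic to `S⁴`. (= the sibling's `stub_contractibleSteinDoubles` MINUS the
Mazur type, which this skeleton PROVES through `stub_mazurDouble` modulo Mazur's theorem, and minus the disc type, a twisted
sphere: so it is the `r ≥ 2` presentation-sphere slice — `∂H⁵(𝒫)` for balanced presentations with ≥ 2 generators in every
Stein handle structure — common to item stmt-SmoothPoincare4-3717 `PresentationSpheresStandard` and to the `ψ = id` sector of
the route's rank-4 crux `ContractibleTwistedDoubleStandard` (stmt-SmoothPoincare4-3546): cross-link
`nonMazurSteinDoubles_of_crux4` PROVES it from crux 4, `nonMazurSteinDoubles_of_siblingStub6` from the sibling's verbatim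
statement.) Andrews–Curtis-adjacent (`StrictPropertyTwoRBarrier` neighbourhood); known for AC-trivial presentations and the
Akbulut–Kirby/Gompf family; why it might fail: one exotic presentation sphere kills it, crux 4, 3717 and SPC4 at once.
SPC4-implied. [cite: Gompf1991Killing] [cite: AndrewsCurtis1965] -/
theorem stub_nonMazurSteinDoubles
    (W : Type) [TopologicalSpace W] [T2Space W] [SecondCountableTopology W]
    [ChartedSpace (EuclideanHalfSpace 4) W] [IsManifold (𝓡∂ 4) ∞ W] [CompactSpace W] [ContractibleSpace W]
    (S : SteinStructure W)
    (hnM : ¬ HasHandleDecomposition 3 W (fun k => if k ≤ 2 then 1 else 0))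
    (hnD : ¬ HasHandleDecomposition 3 W (fun k => if k = 0 then 1 else 0))
    (b : BoundaryData (𝓡∂ 4) W (𝓡 3))
    (P : Type) [TopologicalSpace P] [T2Space P] [SecondCountableTopology P] [ChartedSpace E4 P]
    [IsManifold (𝓡 4) ∞ P] (hP : P ≃ₕ 𝕊⁴) (hD : IsDouble b (𝓡 4) P) :
    Nonempty (P ≃ₘ⟮𝓡 4, 𝓡 4⟯ 𝕊⁴) := by
  sorry

/-! ## Cross-links (sorry-free): the two open residuals are EXISTING items -/

/-- **Stub 7 follows from the route's rank-4 crux `ContractibleTwistedDoubleStandard` (stmt-SmoothPoincare4-3546)** — the landed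
`Negative.double_standard_of_crux` (doubles of compact Stein domains are common-contact Stein bisections). -/
theorem nonMazurSteinDoubles_of_crux4 (h4 : ConvexBisection.ContractibleTwistedDoubleStandard)
    (W : Type) [TopologicalSpace W] [T2Space W] [SecondCountableTopology W]
    [ChartedSpace (EuclideanHalfSpace 4) W] [IsManifold (𝓡∂ 4) ∞ W] [CompactSpace W] [ContractibleSpace W]
    (S : SteinStructure W)
    (_hnM : ¬ HasHandleDecomposition 3 W (fun k => if k ≤ 2 then 1 else 0))
    (_hnD : ¬ HasHandleDecomposition 3 W (fun k => if k = 0 then 1 else 0))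
    (b : BoundaryData (𝓡∂ 4) W (𝓡 3))
    (P : Type) [TopologicalSpace P] [T2Space P] [SecondCountableTopology P] [ChartedSpace E4 P]
    [IsManifold (𝓡 4) ∞ P] (_hP : P ≃ₕ 𝕊⁴) (hD : IsDouble b (𝓡 4) P) :
    Nonempty (P ≃ₘ⟮𝓡 4, 𝓡 4⟯ 𝕊⁴) :=
  double_standard_of_crux h4 W S b P hD

/-- **Stub 7 follows from the sibling's `stub_contractibleSteinDoubles` (VERBATIM its registered statement, exchange-recognition
r3)** — so a proof of that stub, or of item 3717 in Stein clothing, discharges it by `exact`. -/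
theorem nonMazurSteinDoubles_of_siblingStub6
    (h6 : ∀ (W : Type) [TopologicalSpace W] [ChartedSpace (EuclideanHalfSpace 4) W] [IsManifold (𝓡∂ 4) ∞ W]
      [CompactSpace W] [ContractibleSpace W] (_S : SteinStructure W) (b : BoundaryData (𝓡∂ 4) W (𝓡 3))
      (P : Type) [TopologicalSpace P] [T2Space P] [SecondCountableTopology P] [ChartedSpace E4 P]
      [IsManifold (𝓡 4) ∞ P] (_hD : IsDouble b (𝓡 4) P), Nonempty (P ≃ₘ⟮𝓡 4, 𝓡 4⟯ 𝕊⁴))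
    (W : Type) [TopologicalSpace W] [T2Space W] [SecondCountableTopology W]
    [ChartedSpace (EuclideanHalfSpace 4) W] [IsManifold (𝓡∂ 4) ∞ W] [CompactSpace W] [ContractibleSpace W]
    (S : SteinStructure W)
    (_hnM : ¬ HasHandleDecomposition 3 W (fun k => if k ≤ 2 then 1 else 0))
    (_hnD : ¬ HasHandleDecomposition 3 W (fun k => if k = 0 then 1 else 0))
    (b : BoundaryData (𝓡∂ 4) W (𝓡 3))
    (P : Type) [TopologicalSpace P] [T2Space P] [SecondCountableTopology P] [ChartedSpace E4 P]
    [IsManifold (𝓡 4) ∞ P] (_hP : P ≃ₕ 𝕊⁴) (hD : IsDouble b (𝓡 4) P) :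
    Nonempty (P ≃ₘ⟮𝓡 4, 𝓡 4⟯ 𝕊⁴) :=
  h6 W S b P hD

/-- **Stub 6 follows from item stmt-SmoothPoincare4-0377 `NoOneHandles.NoohGscStandard`** (Weak Generalised Property R, bundled
over `HomotopySphere 4`): package `M` — compact (`compactSpace_of_homotopyEquiv_sphere_four_holds`) and orientable
(`isOrientable_of_homotopyEquiv_sphere_four_holds`, both PROVED) — as a `HomotopySphere 4` and apply the item (any `c₂`). So
Stub 6 is `blocked-on: stmt-SmoothPoincare4-0377` in the ledger's sense. -/
theorem gscClosing_of_nooh (h : NoOneHandles.NoohGscStandard)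
    (M : Type) [TopologicalSpace M] [T2Space M] [SecondCountableTopology M] [ChartedSpace E4 M]
    [IsManifold (𝓡 4) ∞ M] (hM : M ≃ₕ 𝕊⁴)
    (F : M → ℝ) (hF : IsMorse (𝓡 4) F) (h1 : criticalSetOfIndex (𝓡 4) F 1 = ∅)
    (_h2 : 1 < (criticalSetOfIndex (𝓡 4) F 2).ncard) :
    Nonempty (M ≃ₘ⟮𝓡 4, 𝓡 4⟯ 𝕊⁴) := by
  haveI : CompactSpace M := compactSpace_of_homotopyEquiv_sphere_four_holds M hM
  obtain ⟨o⟩ := isOrientable_of_homotopyEquiv_sphere_four_holds M hM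
  exact h ⟨M, o, ⟨hM⟩⟩ F hF h1

/-- **The disc sector WITHOUT Eliashberg (reshape s7 cross-link, sorry-free).** A disc-type half makes `M` geometrically simply
connected by `helper_gscOfDiscTypeHalf`, so the disc sector of the crux also closes along the `finish` route: modulo Cerf (C), the
Property-R gluing facts (R, L, T) and item stmt-SmoothPoincare4-0377 (`NoOneHandles.NoohGscStandard`, here the hypothesis `h0377`) — instead
of modulo E and C as in the landed `stub_residualBall`. For the planner's census: the Eliashberg debt E is what spares the disc sector the
open item 0377 (needed there exactly when the non-disc half has `≥ 2` one-handles in the glued function), nothing else. [folklore] -/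
theorem helper_discSector_of_nooh (h0377 : NoOneHandles.NoohGscStandard)
    (hC : cerf_twistedSphere_four) (hPR : isUnknot_of_isIntegralSurgery_zero)
    (hLP : exists_diffeomorph_comp_incl_eq.{0}) (hT : exists_framedKnot_of_hasHandleDecomposition_oneZeroOne)
    (M : Type) [TopologicalSpace M] [T2Space M] [SecondCountableTopology M] [ChartedSpace (EuclideanSpace ℝ (Fin 4)) M]
    [IsManifold (𝓡 4) ∞ M] (hM : M ≃ₕ Metric.sphere (0 : EuclideanSpace ℝ (Fin 5)) 1)
    (W₁ : Type) [TopologicalSpace W₁] [ChartedSpace (EuclideanHalfSpace 4) W₁] [IsManifold (𝓡∂ 4) ∞ W₁]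
    [CompactSpace W₁] (W₂ : Type) [TopologicalSpace W₂] [ChartedSpace (EuclideanHalfSpace 4) W₂]
    [IsManifold (𝓡∂ 4) ∞ W₂] [CompactSpace W₂] (J₁ : SteinStructure W₁) (J₂ : SteinStructure W₂)
    (e₁ : W₁ → M) (e₂ : W₂ → M)
    (he₁ : Manifold.IsSmoothEmbedding (𝓡∂ 4) (𝓡 4) ∞ e₁)
    (he₂ : Manifold.IsSmoothEmbedding (𝓡∂ 4) (𝓡 4) ∞ e₂)
    (hcover : range e₁ ∪ range e₂ = univ)
    (hseam₁ : range e₁ ∩ range e₂ = e₁ '' (𝓡∂ 4).boundary W₁)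
    (hseam₂ : range e₁ ∩ range e₂ = e₂ '' (𝓡∂ 4).boundary W₂)
    (hξ : ∀ w₁ w₂, e₁ w₁ = e₂ w₂ →
      Submodule.map (mfderiv (𝓡∂ 4) (𝓡 4) e₁ w₁).toLinearMap (contactPlane J₁.J w₁) =
      Submodule.map (mfderiv (𝓡∂ 4) (𝓡 4) e₂ w₂).toLinearMap (contactPlane J₂.J w₂))
    (h₁ : HasHandleDecomposition 3 W₁ (fun k => if k = 0 then 1 else 0)) :
    Nonempty (M ≃ₘ⟮𝓡 4, 𝓡 4⟯ Metric.sphere (0 : EuclideanSpace ℝ (Fin 5)) 1) := by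
  obtain ⟨F, hF, h1⟩ := helper_gscOfDiscTypeHalf M hM W₁ W₂ J₁ J₂ e₁ e₂ he₁ he₂ hcover hseam₁ hseam₂ hξ h₁
  by_cases h2 : (criticalSetOfIndex (𝓡 4) F 2).ncard ≤ 1
  · rcases Nat.le_one_iff_eq_zero_or_eq_one.1 h2 with h20 | h21
    · -- `c₂ = 0`: twisted sphere, Cerf
      haveI : CompactSpace M := compactSpace_of_homotopyEquiv_sphere_four_holds M hM
      have hfin2 : (criticalSetOfIndex (𝓡 4) F 2).Finite :=
        (IsMorse.finite_criticalSet_holds hF).subset (criticalSetOfIndex_subset _ F 2)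
      exact stub_propertyRClosing_noTwoHandle hC M hM F hF h1 ((Set.ncard_eq_zero hfin2).1 h20)
    · -- `c₂ = 1`: Property R
      exact landed_stub_propertyR_recognition hC hPR hLP hT M hM F hF h1 h21
  · -- `c₂ ≥ 2`: item 0377
    exact gscClosing_of_nooh h0377 M hM F hF h1 (by omega)

/-! ## Cross-link (sorry-free): lever A is implied by lever B — ONE conjectural statement carries the merged skeleton -/

/-- **Lever A follows from lever B** (reshape s4 cross-link, sorry-free). Given the sibling lever `stub_crossCancellation` (as the
explicit hypothesis `hL`, VERBATIM), the seam-pair dichotomy holds on its whole domain: if a seam-compatible twin `Φ : W₁ ≅ W₂`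
exists, `M` is an `IsDouble` of `W₁` (landed `Negative.isDouble_of_seamCompatible`) — the PARALLEL horn; otherwise lever B, fed
with the `(1,1,1)` structure of `W₂` read as a balanced normal form (`exists_normalForm_of_hasHandleDecomposition_mazurType`),
gives a Morse function with no index-1 point and ONE index-2 point, which the landed `ExchangeRecognition.exists_isMorse_normalForm`
(one minimum, `χ = 2`, cancellation of the extra maxima) normalises to profile `(1,1,1,0,1)` and Milnor's turn-about
(`IsMorse.criticalSetOfIndex_const_sub`) to `(1,0,1,1,1)` — the DUAL horn. So for the planner ONE promoted statement (lever B,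
min-oriented) carries this whole skeleton; lever A is its `n₁ = n₂ = 1` instance weakened by the `IsDouble` exit. [folklore] -/
theorem seamPairDichotomy_of_crossCancellation
    (hL : ∀ (M : Type) [TopologicalSpace M] [T2Space M] [SecondCountableTopology M] [ChartedSpace E4 M]
      [IsManifold (𝓡 4) ∞ M] (_hM : M ≃ₕ 𝕊⁴)
      (W₁ : Type) [TopologicalSpace W₁] [ChartedSpace (EuclideanHalfSpace 4) W₁] [IsManifold (𝓡∂ 4) ∞ W₁]
      [CompactSpace W₁] (W₂ : Type) [TopologicalSpace W₂] [ChartedSpace (EuclideanHalfSpace 4) W₂]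
      [IsManifold (𝓡∂ 4) ∞ W₂] [CompactSpace W₂] (J₁ : SteinStructure W₁) (J₂ : SteinStructure W₂)
      (e₁ : W₁ → M) (e₂ : W₂ → M)
      (_he₁ : Manifold.IsSmoothEmbedding (𝓡∂ 4) (𝓡 4) ∞ e₁)
      (_he₂ : Manifold.IsSmoothEmbedding (𝓡∂ 4) (𝓡 4) ∞ e₂)
      (_hcover : range e₁ ∪ range e₂ = univ)
      (_hseam₁ : range e₁ ∩ range e₂ = e₁ '' (𝓡∂ 4).boundary W₁)
      (_hseam₂ : range e₁ ∩ range e₂ = e₂ '' (𝓡∂ 4).boundary W₂)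
      (_hξ : ∀ w₁ w₂, e₁ w₁ = e₂ w₂ →
        Submodule.map (mfderiv (𝓡∂ 4) (𝓡 4) e₁ w₁).toLinearMap (contactPlane J₁.J w₁) =
        Submodule.map (mfderiv (𝓡∂ 4) (𝓡 4) e₂ w₂).toLinearMap (contactPlane J₂.J w₂))
      (_hac : ∀ k, 0 < k → IsZero (singularHomology ℚ ℚ W₁ k) ∧ IsZero (singularHomology ℚ ℚ W₂ k))
      (f₂ : W₂ → ℝ) (_hf₂ : IsMorseAdapted (𝓡∂ 4) f₂)
      (_hf₂i : ∀ z, IsMCriticalPt (𝓡∂ 4) f₂ z → morseIndex (𝓡∂ 4) f₂ z ≤ 2)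
      (_hf₂0 : (criticalSetOfIndex (𝓡∂ 4) f₂ 0).ncard = 1)
      (_hf₂b : (criticalSetOfIndex (𝓡∂ 4) f₂ 1).ncard = (criticalSetOfIndex (𝓡∂ 4) f₂ 2).ncard)
      (_hnd : ¬ ∃ Φ : W₁ ≃ₘ⟮𝓡∂ 4, 𝓡∂ 4⟯ W₂, ∀ w, w ∈ (𝓡∂ 4).boundary W₁ → e₂ (Φ w) = e₁ w),
      ∃ F : M → ℝ, IsMorse (𝓡 4) F ∧ criticalSetOfIndex (𝓡 4) F 1 = ∅ ∧
        (criticalSetOfIndex (𝓡 4) F 2).ncard = (criticalSetOfIndex (𝓡∂ 4) f₂ 1).ncard)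
    (M : Type) [TopologicalSpace M] [T2Space M] [SecondCountableTopology M] [ChartedSpace E4 M]
    [IsManifold (𝓡 4) ∞ M] (hM : M ≃ₕ 𝕊⁴)
    (W₁ : Type) [TopologicalSpace W₁] [ChartedSpace (EuclideanHalfSpace 4) W₁] [IsManifold (𝓡∂ 4) ∞ W₁]
    [CompactSpace W₁] (W₂ : Type) [TopologicalSpace W₂] [ChartedSpace (EuclideanHalfSpace 4) W₂]
    [IsManifold (𝓡∂ 4) ∞ W₂] [CompactSpace W₂] (J₁ : SteinStructure W₁) (J₂ : SteinStructure W₂)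
    (e₁ : W₁ → M) (e₂ : W₂ → M)
    (he₁ : Manifold.IsSmoothEmbedding (𝓡∂ 4) (𝓡 4) ∞ e₁)
    (he₂ : Manifold.IsSmoothEmbedding (𝓡∂ 4) (𝓡 4) ∞ e₂)
    (hcover : range e₁ ∪ range e₂ = univ)
    (hseam₁ : range e₁ ∩ range e₂ = e₁ '' (𝓡∂ 4).boundary W₁)
    (hseam₂ : range e₁ ∩ range e₂ = e₂ '' (𝓡∂ 4).boundary W₂)
    (hξ : ∀ w₁ w₂, e₁ w₁ = e₂ w₂ →
      Submodule.map (mfderiv (𝓡∂ 4) (𝓡 4) e₁ w₁).toLinearMap (contactPlane J₁.J w₁) =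
      Submodule.map (mfderiv (𝓡∂ 4) (𝓡 4) e₂ w₂).toLinearMap (contactPlane J₂.J w₂))
    (hac : ∀ k, 0 < k → IsZero (singularHomology ℚ ℚ W₁ k) ∧ IsZero (singularHomology ℚ ℚ W₂ k))
    (_h₁ : HasHandleDecomposition 3 W₁ (fun k => if k ≤ 2 then 1 else 0))
    (h₂ : HasHandleDecomposition 3 W₂ (fun k => if k ≤ 2 then 1 else 0))
    (_hB : ¬ (HasHandleDecomposition 3 W₁ (fun k => if k = 0 then 1 else 0) ∨
      HasHandleDecomposition 3 W₂ (fun k => if k = 0 then 1 else 0))) :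
    (∃ F : M → ℝ, IsMorse (𝓡 4) F ∧ (criticalSetOfIndex (𝓡 4) F 0).ncard = 1 ∧
        criticalSetOfIndex (𝓡 4) F 1 = ∅ ∧ (criticalSetOfIndex (𝓡 4) F 2).ncard = 1 ∧
        (criticalSetOfIndex (𝓡 4) F 3).ncard = 1 ∧ (criticalSetOfIndex (𝓡 4) F 4).ncard = 1) ∨
      ∃ b : BoundaryData (𝓡∂ 4) W₁ (𝓡 3), IsDouble b (𝓡 4) M := by
  haveI : T2Space W₁ := he₁.isEmbedding.t2Space
  haveI : SecondCountableTopology W₁ := he₁.isEmbedding.secondCountableTopology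
  haveI : T2Space W₂ := he₂.isEmbedding.t2Space
  haveI : SecondCountableTopology W₂ := he₂.isEmbedding.secondCountableTopology
  by_cases hs : ∃ Φ : W₁ ≃ₘ⟮𝓡∂ 4, 𝓡∂ 4⟯ W₂, ∀ w, w ∈ (𝓡∂ 4).boundary W₁ → e₂ (Φ w) = e₁ w
  · -- PARALLEL horn: a seam-compatible twin presents `M` as a double of `W₁`
    obtain ⟨Φ, hΦ⟩ := hs
    obtain ⟨b⟩ := nonempty_boundaryData_holds 3 W₁
    exact Or.inr ⟨b, isDouble_of_seamCompatible he₁ he₂ hcover hseam₁ Φ hΦ b⟩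
  · -- DUAL horn: lever B with the `(1,1,1)` normal form of `W₂`, then normal form + turn-about
    left
    obtain ⟨f₂, hf₂, hf₂i, hf₂0, hf₂b, hn₂⟩ := exists_normalForm_of_hasHandleDecomposition_mazurType h₂
    obtain ⟨F, hF, h1, hc⟩ := hL M hM W₁ W₂ J₁ J₂ e₁ e₂ he₁ he₂ hcover hseam₁ hseam₂ hξ hac f₂ hf₂ hf₂i hf₂0
      hf₂b hs
    obtain ⟨G, hG, hG0, hG1, hG2, hG3, hG4⟩ := exists_isMorse_normalForm M hM F hF h1
    have hGM : IsMorse (𝓡 4) (fun y => (4 : ℝ) - G y) := hG.const_sub 4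
    have hdim : Module.finrank ℝ E4 = 4 := finrank_euclideanSpace_fin
    have hcs : ∀ k, k ≤ 4 → criticalSetOfIndex (𝓡 4) (fun y => (4 : ℝ) - G y) k =
        criticalSetOfIndex (𝓡 4) G (4 - k) := fun k hk => by
      have h := hG.criticalSetOfIndex_const_sub 4 (k := k) (by rw [hdim]; exact hk)
      rw [hdim] at h
      exact h
    haveI : CompactSpace M := compactSpace_of_homotopyEquiv_sphere_four_holds M hM
    have hfin3 : (criticalSetOfIndex (𝓡 4) G 3).Finite :=
      (IsMorse.finite_criticalSet_holds hG).subset (criticalSetOfIndex_subset _ G 3)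
    refine ⟨fun y => (4 : ℝ) - G y, hGM, ?_, ?_, ?_, ?_, ?_⟩
    · rw [hcs 0 (by norm_num)]; exact hG4
    · rw [hcs 1 (by norm_num)]; exact (Set.ncard_eq_zero hfin3).mp hG3
    · rw [hcs 2 (by norm_num), hG2, hc, hn₂]
    · rw [hcs 3 (by norm_num), hG1, hc, hn₂]
    · rw [hcs 4 (by norm_num)]; exact hG0

/-! ## The composition (kernel-checked, no `sorry` of its own) -/

/-- **The composition: the stubs prove the crux `ConvexBisection.AcyclicBisectionRigidity` BY NAME** (reshape s4/s6; `sorryAx`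
enters only through `stub_*`).
(1) DISC-TYPE HALF (`stub_residualBall`, LANDED, for `W₁` directly and for `W₂` through the symmetry of the crux data).
(2) DOUBLE SECTOR — a seam-compatible twin `Φ : W₁ ≅ W₂` (landed `Negative.isDouble_of_seamCompatible` makes `M` an
`IsDouble` of `W₁`): if `W₁` is Mazur-type, `stub_mazurDouble` (PROVED mod M); otherwise `W₁` is contractible (landed
`stub_doubleHalfContractible`) and `stub_nonMazurSteinDoubles` (item 3546 / 3717).
(3) NON-DOUBLE, NON-DISC — the GSC lever `stub_gscOfNonDouble` (reshape s6, scoped by `hB` in s7) gives a Morse function without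
index-1 critical points, and the closing `finish` splits on its number `c₂` of index-2 points: `c₂ = 0` ⇒ twisted sphere, Cerf (landed
`ExchangeRecognition.stub_propertyRClosing_noTwoHandle`, fact C); `c₂ = 1` ⇒ the LANDED `stub_propertyR_recognition` (facts C, R, L, T);
`c₂ ≥ 2` ⇒ `stub_gscClosing` (item 0377). No normal form and no orientation choice enters any more; the Mazur–Mazur sub-sector (formerly
step (3), lever A) rides along — its finer, 0377-free route is the certificate `mazurMazurSector_of_seamPairDichotomy` (reshape s7). -/
theorem AcyclicBisectionRigidity_of : ConvexBisection.AcyclicBisectionRigidity := by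
  intro M _ _ _ _ _ hM hb
  obtain ⟨W₁, _, _, _, _, W₂, _, _, _, _, J₁, J₂, e₁, e₂, he₁, he₂, hcover, hseam₁, hseam₂, hξ, hac⟩ := hb
  obtain ⟨hR, hL⟩ := stub_factsPropertyRGluing
  have hT : exists_framedKnot_of_hasHandleDecomposition_oneZeroOne := factTrace_of_propertyR hR
  -- the crux data is symmetric in the two halves
  have hcover' : range e₂ ∪ range e₁ = univ := by rw [union_comm]; exact hcover
  have hseam₁' : range e₂ ∩ range e₁ = e₂ '' (𝓡∂ 4).boundary W₂ := by rw [inter_comm]; exact hseam₂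
  have hseam₂' : range e₂ ∩ range e₁ = e₁ '' (𝓡∂ 4).boundary W₁ := by rw [inter_comm]; exact hseam₁
  have hξ' : ∀ w₂ w₁, e₂ w₂ = e₁ w₁ →
      Submodule.map (mfderiv (𝓡∂ 4) (𝓡 4) e₂ w₂).toLinearMap (contactPlane J₂.J w₂) =
      Submodule.map (mfderiv (𝓡∂ 4) (𝓡 4) e₁ w₁).toLinearMap (contactPlane J₁.J w₁) :=
    fun w₂ w₁ h => (hξ w₁ w₂ h.symm).symm
  have hac' : ∀ k, 0 < k → IsZero (singularHomology ℚ ℚ W₂ k) ∧ IsZero (singularHomology ℚ ℚ W₁ k) :=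
    fun k hk => ⟨(hac k hk).2, (hac k hk).1⟩
  haveI : T2Space W₁ := he₁.isEmbedding.t2Space
  haveI : SecondCountableTopology W₁ := he₁.isEmbedding.secondCountableTopology
  haveI : T2Space W₂ := he₂.isEmbedding.t2Space
  haveI : SecondCountableTopology W₂ := he₂.isEmbedding.secondCountableTopology
  -- (1) DISC-TYPE HALF
  by_cases hB : HasHandleDecomposition 3 W₁ (fun k => if k = 0 then 1 else 0) ∨
      HasHandleDecomposition 3 W₂ (fun k => if k = 0 then 1 else 0)
  · rcases hB with h₁ | h₂
    · exact stub_residualBall stub_factEliashberg stub_factCerf M hM W₁ W₂ J₁ J₂ e₁ e₂ he₁ he₂ hcover hseam₁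
        hseam₂ hξ h₁
    · exact stub_residualBall stub_factEliashberg stub_factCerf M hM W₂ W₁ J₂ J₁ e₂ e₁ he₂ he₁ hcover' hseam₁'
        hseam₂' hξ' h₂
  -- the closing of a geometrically simply connected homotopy sphere, split three ways by the number `c₂` of 2-handles
  have finish : ∀ F : M → ℝ, IsMorse (𝓡 4) F → criticalSetOfIndex (𝓡 4) F 1 = ∅ →
      Nonempty (M ≃ₘ⟮𝓡 4, 𝓡 4⟯ 𝕊⁴) := fun F hF h1 => by
    by_cases h2 : (criticalSetOfIndex (𝓡 4) F 2).ncard ≤ 1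
    · rcases Nat.le_one_iff_eq_zero_or_eq_one.1 h2 with h20 | h21
      · -- `c₂ = 0`: twisted sphere, Cerf
        haveI : CompactSpace M := compactSpace_of_homotopyEquiv_sphere_four_holds M hM
        have hfin2 : (criticalSetOfIndex (𝓡 4) F 2).Finite :=
          (IsMorse.finite_criticalSet_holds hF).subset (criticalSetOfIndex_subset _ F 2)
        exact stub_propertyRClosing_noTwoHandle stub_factCerf M hM F hF h1 ((Set.ncard_eq_zero hfin2).1 h20)
      · -- `c₂ = 1`: Property R
        exact stub_propertyR_recognition stub_factCerf hR hL hT M hM F hF h1 h21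
    · -- `c₂ ≥ 2`: item 0377
      exact stub_gscClosing M hM F hF h1 (by omega)
  -- (2) DOUBLE SECTOR: a seam-compatible twin presents `M` as a double of `W₁`
  by_cases hs : ∃ Φ : W₁ ≃ₘ⟮𝓡∂ 4, 𝓡∂ 4⟯ W₂, ∀ w, w ∈ (𝓡∂ 4).boundary W₁ → e₂ (Φ w) = e₁ w
  · obtain ⟨Φ, hΦ⟩ := hs
    obtain ⟨b⟩ := nonempty_boundaryData_holds 3 W₁
    have hD : IsDouble b (𝓡 4) M := isDouble_of_seamCompatible he₁ he₂ hcover hseam₁ Φ hΦ b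
    by_cases h₁ : HasHandleDecomposition 3 W₁ (fun k => if k ≤ 2 then 1 else 0)
    · exact stub_mazurDouble stub_factMazur W₁ J₁ h₁ (fun k hk => (hac k hk).1) b M hM hD
    · haveI : ContractibleSpace W₁ := stub_doubleHalfContractible W₁ (fun k hk => (hac k hk).1) b M hD hM
      exact stub_nonMazurSteinDoubles W₁ J₁ h₁ (fun h => hB (Or.inl h)) b M hM hD
  -- (3) NON-DOUBLE, NON-DISC: the GSC lever, then the three-way closing (reshape s7: the Mazur–Mazur sub-sector rides along;
  --     its finer route through lever A is the certificate `mazurMazurSector_of_seamPairDichotomy`)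
  obtain ⟨F, hF, h1⟩ := stub_gscOfNonDouble M hM W₁ W₂ J₁ J₂ e₁ e₂ he₁ he₂ hcover hseam₁ hseam₂ hξ hac hs hB
  exact finish F hF h1

/-! ## Cross-links (sorry-free): what is shielded, and the parallel horn against crux 4 -/

/-- **The open residual stub is implied by the crux** (it is the crux restricted to its sector): it is therefore
SPC4-shielded (Disproof §1 `shielded_of_spc4`) and carries no content of the line — honest labelling for the lead
(delegate / wave, never hold). -/
theorem residualMany_of_crux (h : ConvexBisection.AcyclicBisectionRigidity)
    (M : Type) [TopologicalSpace M] [T2Space M] [SecondCountableTopology M] [ChartedSpace E4 M]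
    [IsManifold (𝓡 4) ∞ M] (hM : M ≃ₕ 𝕊⁴)
    (W₁ : Type) [TopologicalSpace W₁] [ChartedSpace (EuclideanHalfSpace 4) W₁] [IsManifold (𝓡∂ 4) ∞ W₁]
    [CompactSpace W₁] (W₂ : Type) [TopologicalSpace W₂] [ChartedSpace (EuclideanHalfSpace 4) W₂]
    [IsManifold (𝓡∂ 4) ∞ W₂] [CompactSpace W₂] (J₁ : SteinStructure W₁) (J₂ : SteinStructure W₂)
    (e₁ : W₁ → M) (e₂ : W₂ → M)
    (he₁ : Manifold.IsSmoothEmbedding (𝓡∂ 4) (𝓡 4) ∞ e₁)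
    (he₂ : Manifold.IsSmoothEmbedding (𝓡∂ 4) (𝓡 4) ∞ e₂)
    (hcover : range e₁ ∪ range e₂ = univ)
    (hseam₁ : range e₁ ∩ range e₂ = e₁ '' (𝓡∂ 4).boundary W₁)
    (hseam₂ : range e₁ ∩ range e₂ = e₂ '' (𝓡∂ 4).boundary W₂)
    (hξ : ∀ w₁ w₂, e₁ w₁ = e₂ w₂ →
      Submodule.map (mfderiv (𝓡∂ 4) (𝓡 4) e₁ w₁).toLinearMap (contactPlane J₁.J w₁) =
      Submodule.map (mfderiv (𝓡∂ 4) (𝓡 4) e₂ w₂).toLinearMap (contactPlane J₂.J w₂))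
    (hac : ∀ k, 0 < k → IsZero (singularHomology ℚ ℚ W₁ k) ∧ IsZero (singularHomology ℚ ℚ W₂ k))
    (_hB : ¬ (HasHandleDecomposition 3 W₁ (fun k => if k = 0 then 1 else 0) ∨
      HasHandleDecomposition 3 W₂ (fun k => if k = 0 then 1 else 0)))
    (_hMM : ¬ (HasHandleDecomposition 3 W₁ (fun k => if k ≤ 2 then 1 else 0) ∧
      HasHandleDecomposition 3 W₂ (fun k => if k ≤ 2 then 1 else 0))) :
    Nonempty (M ≃ₘ⟮𝓡 4, 𝓡 4⟯ 𝕊⁴) :=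
  h M hM ⟨W₁, _, _, _, _, W₂, _, _, _, _, J₁, J₂, e₁, e₂, he₁, he₂, hcover, hseam₁, hseam₂, hξ, hac⟩

/-- **The parallel horn against crux 4.** For a CONTRACTIBLE Stein `W` the conclusion of `stub_mazurDouble`
(indeed for any handle type, and without `P ≃ₕ S⁴`) follows from the route's rank-4 crux
`ContractibleTwistedDoubleStandard` (item stmt-SmoothPoincare4-3546), by the sibling Negative lemma
`double_standard_of_crux` (a double of a compact Stein domain is a common-contact Stein bisection). So what
`stub_mazurDouble` adds to item 3546 is exactly Mazur's theorem for the presentation `⟨x ∣ x⟩` plus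
"homotopy-sphere doubles of `(1,1,1)`-handlebodies have contractible halves". -/
theorem mazurDouble_of_crux4_of_contractible (h4 : ConvexBisection.ContractibleTwistedDoubleStandard)
    (W : Type) [TopologicalSpace W] [ChartedSpace (EuclideanHalfSpace 4) W] [IsManifold (𝓡∂ 4) ∞ W]
    [CompactSpace W] [ContractibleSpace W] (J : SteinStructure W) (b : BoundaryData (𝓡∂ 4) W (𝓡 3))
    (P : Type) [TopologicalSpace P] [T2Space P] [SecondCountableTopology P] [ChartedSpace E4 P]
    [IsManifold (𝓡 4) ∞ P] (hD : IsDouble b (𝓡 4) P) :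
    Nonempty (P ≃ₘ⟮𝓡 4, 𝓡 4⟯ 𝕊⁴) :=
  Summit.SmoothPoincare4.SmoothPoincare4.Theorems.ContractibleTwistedDoubleStandard.Negative.double_standard_of_crux
    h4 W J b P hD

/-- **Reshape s1 cross-link: under the data of `stub_mazurDouble` the half `W` is contractible** (landed
`ExchangeRecognition.stub_doubleHalfContractible`, p89382: fold retraction + duality + Whitehead), so `stub_mazurDouble`
follows from crux 4 (`mazurDouble_of_crux4_of_contractible`) and, unconditionally, IS Mazur's theorem for contractible
`(1,1,1)`-handlebodies. -/
theorem contractibleSpace_of_mazurDouble_data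
    (W : Type) [TopologicalSpace W] [T2Space W] [SecondCountableTopology W]
    [ChartedSpace (EuclideanHalfSpace 4) W] [IsManifold (𝓡∂ 4) ∞ W] [CompactSpace W]
    (hac : ∀ k, 0 < k → IsZero (singularHomology ℚ ℚ W k))
    (b : BoundaryData (𝓡∂ 4) W (𝓡 3))
    (P : Type) [TopologicalSpace P] [T2Space P] [SecondCountableTopology P] [ChartedSpace E4 P]
    [IsManifold (𝓡 4) ∞ P] (hP : P ≃ₕ 𝕊⁴) (hD : IsDouble b (𝓡 4) P) :
    ContractibleSpace W :=
  stub_doubleHalfContractible W hac b P hD hP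

/-- **Reshape s1 cross-link: `stub_mazurDouble` from crux 4 alone** (no contractibility hypothesis left: it is supplied by
`contractibleSpace_of_mazurDouble_data`). So the parallel horn is staffed by item stmt-SmoothPoincare4-3546 if Mazur's theorem
does not land first. -/
theorem mazurDouble_of_crux4 (h4 : ConvexBisection.ContractibleTwistedDoubleStandard)
    (W : Type) [TopologicalSpace W] [T2Space W] [SecondCountableTopology W]
    [ChartedSpace (EuclideanHalfSpace 4) W] [IsManifold (𝓡∂ 4) ∞ W] [CompactSpace W]
    (J : SteinStructure W) (hac : ∀ k, 0 < k → IsZero (singularHomology ℚ ℚ W k))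
    (b : BoundaryData (𝓡∂ 4) W (𝓡 3))
    (P : Type) [TopologicalSpace P] [T2Space P] [SecondCountableTopology P] [ChartedSpace E4 P]
    [IsManifold (𝓡 4) ∞ P] (hP : P ≃ₕ 𝕊⁴) (hD : IsDouble b (𝓡 4) P) :
    Nonempty (P ≃ₘ⟮𝓡 4, 𝓡 4⟯ 𝕊⁴) :=
  haveI := contractibleSpace_of_mazurDouble_data W hac b P hP hD
  mazurDouble_of_crux4_of_contractible h4 W J b P hD


/-! ## Cross-links (sorry-free, reshape s6): the GSC lever is sandwiched `lever B ⇒ GSC ⇐ crux ⇐ SPC4`; lever A `⇐ crux ⇐ SPC4` too -/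

/-- **Lever B (VERBATIM the sibling's `ExchangeRecognition.stub_crossCancellation`, as the hypothesis `hL`) implies the GSC lever**:
feed it the landed balanced Stein normal form of `W₂` (`stub_steinHandleNormalForm` with the crux data swapped, `stub_factGompf`) and
forget the 2-handle count. So a proof of the statement lead a1-0 handed back `promote-stub` closes `stub_gscOfNonDouble` by `exact`, and
the GSC lever is at most as strong as lever B. [folklore] -/
theorem gscOfNonDouble_of_crossCancellation
    (hL : ∀ (M : Type) [TopologicalSpace M] [T2Space M] [SecondCountableTopology M] [ChartedSpace (EuclideanSpace ℝ (Fin 4)) M]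
      [IsManifold (𝓡 4) ∞ M] (_hM : M ≃ₕ Metric.sphere (0 : EuclideanSpace ℝ (Fin 5)) 1)
      (W₁ : Type) [TopologicalSpace W₁] [ChartedSpace (EuclideanHalfSpace 4) W₁] [IsManifold (𝓡∂ 4) ∞ W₁]
      [CompactSpace W₁] (W₂ : Type) [TopologicalSpace W₂] [ChartedSpace (EuclideanHalfSpace 4) W₂]
      [IsManifold (𝓡∂ 4) ∞ W₂] [CompactSpace W₂] (J₁ : SteinStructure W₁) (J₂ : SteinStructure W₂)
      (e₁ : W₁ → M) (e₂ : W₂ → M)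
      (_he₁ : Manifold.IsSmoothEmbedding (𝓡∂ 4) (𝓡 4) ∞ e₁)
      (_he₂ : Manifold.IsSmoothEmbedding (𝓡∂ 4) (𝓡 4) ∞ e₂)
      (_hcover : range e₁ ∪ range e₂ = univ)
      (_hseam₁ : range e₁ ∩ range e₂ = e₁ '' (𝓡∂ 4).boundary W₁)
      (_hseam₂ : range e₁ ∩ range e₂ = e₂ '' (𝓡∂ 4).boundary W₂)
      (_hξ : ∀ w₁ w₂, e₁ w₁ = e₂ w₂ →
        Submodule.map (mfderiv (𝓡∂ 4) (𝓡 4) e₁ w₁).toLinearMap (contactPlane J₁.J w₁) =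
        Submodule.map (mfderiv (𝓡∂ 4) (𝓡 4) e₂ w₂).toLinearMap (contactPlane J₂.J w₂))
      (_hac : ∀ k, 0 < k → IsZero (singularHomology ℚ ℚ W₁ k) ∧ IsZero (singularHomology ℚ ℚ W₂ k))
      (f₂ : W₂ → ℝ) (_hf₂ : IsMorseAdapted (𝓡∂ 4) f₂)
      (_hf₂i : ∀ z, IsMCriticalPt (𝓡∂ 4) f₂ z → morseIndex (𝓡∂ 4) f₂ z ≤ 2)
      (_hf₂0 : (criticalSetOfIndex (𝓡∂ 4) f₂ 0).ncard = 1)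
      (_hf₂b : (criticalSetOfIndex (𝓡∂ 4) f₂ 1).ncard = (criticalSetOfIndex (𝓡∂ 4) f₂ 2).ncard)
      (_hnd : ¬ ∃ Φ : W₁ ≃ₘ⟮𝓡∂ 4, 𝓡∂ 4⟯ W₂, ∀ w, w ∈ (𝓡∂ 4).boundary W₁ → e₂ (Φ w) = e₁ w),
      ∃ F : M → ℝ, IsMorse (𝓡 4) F ∧ criticalSetOfIndex (𝓡 4) F 1 = ∅ ∧
        (criticalSetOfIndex (𝓡 4) F 2).ncard = (criticalSetOfIndex (𝓡∂ 4) f₂ 1).ncard)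
    (M : Type) [TopologicalSpace M] [T2Space M] [SecondCountableTopology M] [ChartedSpace (EuclideanSpace ℝ (Fin 4)) M]
    [IsManifold (𝓡 4) ∞ M] (hM : M ≃ₕ Metric.sphere (0 : EuclideanSpace ℝ (Fin 5)) 1)
    (W₁ : Type) [TopologicalSpace W₁] [ChartedSpace (EuclideanHalfSpace 4) W₁] [IsManifold (𝓡∂ 4) ∞ W₁]
    [CompactSpace W₁] (W₂ : Type) [TopologicalSpace W₂] [ChartedSpace (EuclideanHalfSpace 4) W₂]
    [IsManifold (𝓡∂ 4) ∞ W₂] [CompactSpace W₂] (J₁ : SteinStructure W₁) (J₂ : SteinStructure W₂)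
    (e₁ : W₁ → M) (e₂ : W₂ → M)
    (he₁ : Manifold.IsSmoothEmbedding (𝓡∂ 4) (𝓡 4) ∞ e₁)
    (he₂ : Manifold.IsSmoothEmbedding (𝓡∂ 4) (𝓡 4) ∞ e₂)
    (hcover : range e₁ ∪ range e₂ = univ)
    (hseam₁ : range e₁ ∩ range e₂ = e₁ '' (𝓡∂ 4).boundary W₁)
    (hseam₂ : range e₁ ∩ range e₂ = e₂ '' (𝓡∂ 4).boundary W₂)
    (hξ : ∀ w₁ w₂, e₁ w₁ = e₂ w₂ →
      Submodule.map (mfderiv (𝓡∂ 4) (𝓡 4) e₁ w₁).toLinearMap (contactPlane J₁.J w₁) =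
      Submodule.map (mfderiv (𝓡∂ 4) (𝓡 4) e₂ w₂).toLinearMap (contactPlane J₂.J w₂))
    (hac : ∀ k, 0 < k → IsZero (singularHomology ℚ ℚ W₁ k) ∧ IsZero (singularHomology ℚ ℚ W₂ k))
    (hnd : ¬ ∃ Φ : W₁ ≃ₘ⟮𝓡∂ 4, 𝓡∂ 4⟯ W₂, ∀ w, w ∈ (𝓡∂ 4).boundary W₁ → e₂ (Φ w) = e₁ w) :
    ∃ F : M → ℝ, IsMorse (𝓡 4) F ∧ criticalSetOfIndex (𝓡 4) F 1 = ∅ := by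
  -- the crux data is symmetric in the two halves: a balanced Stein normal form of `W₂`
  have hcover' : range e₂ ∪ range e₁ = univ := by rw [union_comm]; exact hcover
  have hseam₁' : range e₂ ∩ range e₁ = e₂ '' (𝓡∂ 4).boundary W₂ := by rw [inter_comm]; exact hseam₂
  have hseam₂' : range e₂ ∩ range e₁ = e₁ '' (𝓡∂ 4).boundary W₁ := by rw [inter_comm]; exact hseam₁
  have hξ' : ∀ w₂ w₁, e₂ w₂ = e₁ w₁ →
      Submodule.map (mfderiv (𝓡∂ 4) (𝓡 4) e₂ w₂).toLinearMap (contactPlane J₂.J w₂) =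
      Submodule.map (mfderiv (𝓡∂ 4) (𝓡 4) e₁ w₁).toLinearMap (contactPlane J₁.J w₁) :=
    fun w₂ w₁ h => (hξ w₁ w₂ h.symm).symm
  have hac' : ∀ k, 0 < k → IsZero (singularHomology ℚ ℚ W₂ k) ∧ IsZero (singularHomology ℚ ℚ W₁ k) :=
    fun k hk => ⟨(hac k hk).2, (hac k hk).1⟩
  obtain ⟨f₂, hf₂, hf₂i, hf₂0, hf₂b⟩ :=
    stub_steinHandleNormalForm stub_factGompf M hM W₂ W₁ J₂ J₁ e₂ e₁ he₂ he₁ hcover' hseam₁' hseam₂' hξ' hac'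
  obtain ⟨F, hF, h1, -⟩ := hL M hM W₁ W₂ J₁ J₂ e₁ e₂ he₁ he₂ hcover hseam₁ hseam₂ hξ hac f₂ hf₂ hf₂i hf₂0
    hf₂b hnd
  exact ⟨F, hF, h1⟩

/-- **The GSC lever is implied by the crux** (it is the crux restricted to its sector, read through a Morse function of `S⁴`): given
`M ≅ S⁴`, pull back the tree's Morse function on the round sphere with profile `(1, 0, 1, 1, 1)` (`exists_isMorse_sphereFour_twoThree`,
Milnor's height function with one birth) along the diffeomorphism (`SeamGluing.IsMorse.comp_diffeomorph`,
`SeamGluing.criticalSetOfIndex_comp_diffeomorph`, lead c1). Hence the stub is SPC4-shielded (`gscOfNonDouble_of_spc4`): refutable only by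
an exotic 4-sphere — CERTIFIED here, where for lever B verbatim (prescribed 2-handle count `n₂`) the same certificate would need births
of `n₂` cancelling `2/3` pairs on `S⁴`, not in the tree. Honest labelling for the planner: the statement to PROMOTE is this one.
[folklore] -/
theorem gscOfNonDouble_of_crux (h : ConvexBisection.AcyclicBisectionRigidity)
    (M : Type) [TopologicalSpace M] [T2Space M] [SecondCountableTopology M] [ChartedSpace (EuclideanSpace ℝ (Fin 4)) M]
    [IsManifold (𝓡 4) ∞ M] (hM : M ≃ₕ Metric.sphere (0 : EuclideanSpace ℝ (Fin 5)) 1)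
    (W₁ : Type) [TopologicalSpace W₁] [ChartedSpace (EuclideanHalfSpace 4) W₁] [IsManifold (𝓡∂ 4) ∞ W₁]
    [CompactSpace W₁] (W₂ : Type) [TopologicalSpace W₂] [ChartedSpace (EuclideanHalfSpace 4) W₂]
    [IsManifold (𝓡∂ 4) ∞ W₂] [CompactSpace W₂] (J₁ : SteinStructure W₁) (J₂ : SteinStructure W₂)
    (e₁ : W₁ → M) (e₂ : W₂ → M)
    (he₁ : Manifold.IsSmoothEmbedding (𝓡∂ 4) (𝓡 4) ∞ e₁)
    (he₂ : Manifold.IsSmoothEmbedding (𝓡∂ 4) (𝓡 4) ∞ e₂)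
    (hcover : range e₁ ∪ range e₂ = univ)
    (hseam₁ : range e₁ ∩ range e₂ = e₁ '' (𝓡∂ 4).boundary W₁)
    (hseam₂ : range e₁ ∩ range e₂ = e₂ '' (𝓡∂ 4).boundary W₂)
    (hξ : ∀ w₁ w₂, e₁ w₁ = e₂ w₂ →
      Submodule.map (mfderiv (𝓡∂ 4) (𝓡 4) e₁ w₁).toLinearMap (contactPlane J₁.J w₁) =
      Submodule.map (mfderiv (𝓡∂ 4) (𝓡 4) e₂ w₂).toLinearMap (contactPlane J₂.J w₂))
    (hac : ∀ k, 0 < k → IsZero (singularHomology ℚ ℚ W₁ k) ∧ IsZero (singularHomology ℚ ℚ W₂ k))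
    (_hnd : ¬ ∃ Φ : W₁ ≃ₘ⟮𝓡∂ 4, 𝓡∂ 4⟯ W₂, ∀ w, w ∈ (𝓡∂ 4).boundary W₁ → e₂ (Φ w) = e₁ w) :
    ∃ F : M → ℝ, IsMorse (𝓡 4) F ∧ criticalSetOfIndex (𝓡 4) F 1 = ∅ := by
  obtain ⟨Φ⟩ := h M hM ⟨W₁, _, _, _, _, W₂, _, _, _, _, J₁, J₂, e₁, e₂, he₁, he₂, hcover, hseam₁, hseam₂, hξ, hac⟩
  obtain ⟨f, -, hf, hfin, -, hf1, -⟩ := exists_isMorse_sphereFour_twoThree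
  refine ⟨f ∘ Φ, IsMorse.comp_diffeomorph Φ hf, ?_⟩
  rw [criticalSetOfIndex_comp_diffeomorph Φ hf.contMDiff 1]
  have hfin1 : (criticalSetOfIndex (𝓡 4) f 1).Finite := hfin.subset (criticalSetOfIndex_subset _ f 1)
  rw [(Set.ncard_eq_zero hfin1).1 hf1, Set.preimage_empty]

/-- **Hence the GSC lever is SPC4-shielded**: `SmoothPoincare4` implies it (Disproof §1 `shielded_of_spc4`, here through
`gscOfNonDouble_of_crux` and the landed `Negative.not_smoothPoincare4_of_not_crux`). [folklore] -/
theorem gscOfNonDouble_of_spc4 (h : SmoothPoincare4)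
    (M : Type) [TopologicalSpace M] [T2Space M] [SecondCountableTopology M] [ChartedSpace (EuclideanSpace ℝ (Fin 4)) M]
    [IsManifold (𝓡 4) ∞ M] (hM : M ≃ₕ Metric.sphere (0 : EuclideanSpace ℝ (Fin 5)) 1)
    (W₁ : Type) [TopologicalSpace W₁] [ChartedSpace (EuclideanHalfSpace 4) W₁] [IsManifold (𝓡∂ 4) ∞ W₁]
    [CompactSpace W₁] (W₂ : Type) [TopologicalSpace W₂] [ChartedSpace (EuclideanHalfSpace 4) W₂]
    [IsManifold (𝓡∂ 4) ∞ W₂] [CompactSpace W₂] (J₁ : SteinStructure W₁) (J₂ : SteinStructure W₂)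
    (e₁ : W₁ → M) (e₂ : W₂ → M)
    (he₁ : Manifold.IsSmoothEmbedding (𝓡∂ 4) (𝓡 4) ∞ e₁)
    (he₂ : Manifold.IsSmoothEmbedding (𝓡∂ 4) (𝓡 4) ∞ e₂)
    (hcover : range e₁ ∪ range e₂ = univ)
    (hseam₁ : range e₁ ∩ range e₂ = e₁ '' (𝓡∂ 4).boundary W₁)
    (hseam₂ : range e₁ ∩ range e₂ = e₂ '' (𝓡∂ 4).boundary W₂)
    (hξ : ∀ w₁ w₂, e₁ w₁ = e₂ w₂ →
      Submodule.map (mfderiv (𝓡∂ 4) (𝓡 4) e₁ w₁).toLinearMap (contactPlane J₁.J w₁) =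
      Submodule.map (mfderiv (𝓡∂ 4) (𝓡 4) e₂ w₂).toLinearMap (contactPlane J₂.J w₂))
    (hac : ∀ k, 0 < k → IsZero (singularHomology ℚ ℚ W₁ k) ∧ IsZero (singularHomology ℚ ℚ W₂ k))
    (hnd : ¬ ∃ Φ : W₁ ≃ₘ⟮𝓡∂ 4, 𝓡∂ 4⟯ W₂, ∀ w, w ∈ (𝓡∂ 4).boundary W₁ → e₂ (Φ w) = e₁ w) :
    ∃ F : M → ℝ, IsMorse (𝓡 4) F ∧ criticalSetOfIndex (𝓡 4) F 1 = ∅ := by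
  have hcrux : ConvexBisection.AcyclicBisectionRigidity := by
    by_contra hn
    exact Summit.SmoothPoincare4.SmoothPoincare4.Theorems.AcyclicBisectionRigidity.Negative.not_smoothPoincare4_of_not_crux hn h
  exact gscOfNonDouble_of_crux hcrux M hM W₁ W₂ J₁ J₂ e₁ e₂ he₁ he₂ hcover hseam₁ hseam₂ hξ hac hnd


/-- **Lever A is implied by the crux as well** (hence SPC4-shielded, `seamPairDichotomy_of_spc4`): given `M ≅ S⁴`, the pulled-back
`exists_isMorse_sphereFour_twoThree` has profile exactly `(1, 0, 1, 1, 1)` (`SeamGluing.ncard_criticalSetOfIndex_comp_diffeomorph`), which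
is the first horn. Certified here for the record: of the three conjectural statements of the round-2 seam lines only lever B VERBATIM
(prescribed count `n₂`) lacks this certificate in the tree (births of cancelling pairs). [folklore] -/
theorem seamPairDichotomy_of_crux (h : ConvexBisection.AcyclicBisectionRigidity)
    (M : Type) [TopologicalSpace M] [T2Space M] [SecondCountableTopology M] [ChartedSpace (EuclideanSpace ℝ (Fin 4)) M]
    [IsManifold (𝓡 4) ∞ M] (hM : M ≃ₕ Metric.sphere (0 : EuclideanSpace ℝ (Fin 5)) 1)
    (W₁ : Type) [TopologicalSpace W₁] [ChartedSpace (EuclideanHalfSpace 4) W₁] [IsManifold (𝓡∂ 4) ∞ W₁]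
    [CompactSpace W₁] (W₂ : Type) [TopologicalSpace W₂] [ChartedSpace (EuclideanHalfSpace 4) W₂]
    [IsManifold (𝓡∂ 4) ∞ W₂] [CompactSpace W₂] (J₁ : SteinStructure W₁) (J₂ : SteinStructure W₂)
    (e₁ : W₁ → M) (e₂ : W₂ → M)
    (he₁ : Manifold.IsSmoothEmbedding (𝓡∂ 4) (𝓡 4) ∞ e₁)
    (he₂ : Manifold.IsSmoothEmbedding (𝓡∂ 4) (𝓡 4) ∞ e₂)
    (hcover : range e₁ ∪ range e₂ = univ)
    (hseam₁ : range e₁ ∩ range e₂ = e₁ '' (𝓡∂ 4).boundary W₁)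
    (hseam₂ : range e₁ ∩ range e₂ = e₂ '' (𝓡∂ 4).boundary W₂)
    (hξ : ∀ w₁ w₂, e₁ w₁ = e₂ w₂ →
      Submodule.map (mfderiv (𝓡∂ 4) (𝓡 4) e₁ w₁).toLinearMap (contactPlane J₁.J w₁) =
      Submodule.map (mfderiv (𝓡∂ 4) (𝓡 4) e₂ w₂).toLinearMap (contactPlane J₂.J w₂))
    (hac : ∀ k, 0 < k → IsZero (singularHomology ℚ ℚ W₁ k) ∧ IsZero (singularHomology ℚ ℚ W₂ k))
    (_h₁ : HasHandleDecomposition 3 W₁ (fun k => if k ≤ 2 then 1 else 0))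
    (_h₂ : HasHandleDecomposition 3 W₂ (fun k => if k ≤ 2 then 1 else 0))
    (_hB : ¬ (HasHandleDecomposition 3 W₁ (fun k => if k = 0 then 1 else 0) ∨
      HasHandleDecomposition 3 W₂ (fun k => if k = 0 then 1 else 0))) :
    (∃ F : M → ℝ, IsMorse (𝓡 4) F ∧ (criticalSetOfIndex (𝓡 4) F 0).ncard = 1 ∧
        criticalSetOfIndex (𝓡 4) F 1 = ∅ ∧ (criticalSetOfIndex (𝓡 4) F 2).ncard = 1 ∧
        (criticalSetOfIndex (𝓡 4) F 3).ncard = 1 ∧ (criticalSetOfIndex (𝓡 4) F 4).ncard = 1) ∨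
      ∃ b : BoundaryData (𝓡∂ 4) W₁ (𝓡 3), IsDouble b (𝓡 4) M := by
  left
  obtain ⟨Φ⟩ := h M hM ⟨W₁, _, _, _, _, W₂, _, _, _, _, J₁, J₂, e₁, e₂, he₁, he₂, hcover, hseam₁, hseam₂, hξ, hac⟩
  obtain ⟨f, -, hf, hfin, hf0, hf1, hf2, hf3, hf4, -⟩ := exists_isMorse_sphereFour_twoThree
  have hn := fun k => ncard_criticalSetOfIndex_comp_diffeomorph Φ hf.contMDiff k
  refine ⟨f ∘ Φ, IsMorse.comp_diffeomorph Φ hf, by rw [hn 0, hf0], ?_, by rw [hn 2, hf2], by rw [hn 3, hf3],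
    by rw [hn 4, hf4]⟩
  rw [criticalSetOfIndex_comp_diffeomorph Φ hf.contMDiff 1]
  have hfin1 : (criticalSetOfIndex (𝓡 4) f 1).Finite := hfin.subset (criticalSetOfIndex_subset _ f 1)
  rw [(Set.ncard_eq_zero hfin1).1 hf1, Set.preimage_empty]

/-- **Hence lever A is SPC4-shielded** (certified). [folklore] -/
theorem seamPairDichotomy_of_spc4 (h : SmoothPoincare4)
    (M : Type) [TopologicalSpace M] [T2Space M] [SecondCountableTopology M] [ChartedSpace (EuclideanSpace ℝ (Fin 4)) M]
    [IsManifold (𝓡 4) ∞ M] (hM : M ≃ₕ Metric.sphere (0 : EuclideanSpace ℝ (Fin 5)) 1)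
    (W₁ : Type) [TopologicalSpace W₁] [ChartedSpace (EuclideanHalfSpace 4) W₁] [IsManifold (𝓡∂ 4) ∞ W₁]
    [CompactSpace W₁] (W₂ : Type) [TopologicalSpace W₂] [ChartedSpace (EuclideanHalfSpace 4) W₂]
    [IsManifold (𝓡∂ 4) ∞ W₂] [CompactSpace W₂] (J₁ : SteinStructure W₁) (J₂ : SteinStructure W₂)
    (e₁ : W₁ → M) (e₂ : W₂ → M)
    (he₁ : Manifold.IsSmoothEmbedding (𝓡∂ 4) (𝓡 4) ∞ e₁)
    (he₂ : Manifold.IsSmoothEmbedding (𝓡∂ 4) (𝓡 4) ∞ e₂)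
    (hcover : range e₁ ∪ range e₂ = univ)
    (hseam₁ : range e₁ ∩ range e₂ = e₁ '' (𝓡∂ 4).boundary W₁)
    (hseam₂ : range e₁ ∩ range e₂ = e₂ '' (𝓡∂ 4).boundary W₂)
    (hξ : ∀ w₁ w₂, e₁ w₁ = e₂ w₂ →
      Submodule.map (mfderiv (𝓡∂ 4) (𝓡 4) e₁ w₁).toLinearMap (contactPlane J₁.J w₁) =
      Submodule.map (mfderiv (𝓡∂ 4) (𝓡 4) e₂ w₂).toLinearMap (contactPlane J₂.J w₂))
    (hac : ∀ k, 0 < k → IsZero (singularHomology ℚ ℚ W₁ k) ∧ IsZero (singularHomology ℚ ℚ W₂ k))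
    (h₁ : HasHandleDecomposition 3 W₁ (fun k => if k ≤ 2 then 1 else 0))
    (h₂ : HasHandleDecomposition 3 W₂ (fun k => if k ≤ 2 then 1 else 0))
    (hB : ¬ (HasHandleDecomposition 3 W₁ (fun k => if k = 0 then 1 else 0) ∨
      HasHandleDecomposition 3 W₂ (fun k => if k = 0 then 1 else 0))) :
    (∃ F : M → ℝ, IsMorse (𝓡 4) F ∧ (criticalSetOfIndex (𝓡 4) F 0).ncard = 1 ∧
        criticalSetOfIndex (𝓡 4) F 1 = ∅ ∧ (criticalSetOfIndex (𝓡 4) F 2).ncard = 1 ∧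
        (criticalSetOfIndex (𝓡 4) F 3).ncard = 1 ∧ (criticalSetOfIndex (𝓡 4) F 4).ncard = 1) ∨
      ∃ b : BoundaryData (𝓡∂ 4) W₁ (𝓡 3), IsDouble b (𝓡 4) M := by
  have hcrux : ConvexBisection.AcyclicBisectionRigidity := by
    by_contra hn
    exact Summit.SmoothPoincare4.SmoothPoincare4.Theorems.AcyclicBisectionRigidity.Negative.not_smoothPoincare4_of_not_crux hn h
  exact seamPairDichotomy_of_crux hcrux M hM W₁ W₂ J₁ J₂ e₁ e₂ he₁ he₂ hcover hseam₁ hseam₂ hξ hac h₁ h₂ hB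

end Summit.SmoothPoincare4.SmoothPoincare4.Cruxes.AcyclicBisectionRigidity.SeamDualityCancellation

end
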